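import Literature.NumberTheory.Transcendental.TwoCurveThetaLaws
import Literature.NumberTheory.Transcendental.PkappaThetaTangent
import HarnessLib

/-!
# The cone over the theta model of the two-lattice standard models: tangent spaces, Jacobian criterion, image theorem

Topic `Literature/NumberTheory/Transcendental`; unit
`provefact-Literature.NumberTheory.Transcendental.H-a66b67e3eb` (fact
`Literature.NumberTheory.Transcendental.HuberWustholzTwoCurvePeriods`). It introduces NO named fact.
Two-lattice counterpart (stage P2 of the port of the discharge programme of Philippon's zero
estimate to the two-lattice theta model) of the model-level parts of `PkappaThetaChartIdentities.lean`
and `PkappaThetaTangent.lean`, for the theta model of `M = 𝔾ₘ^β × P` with blockwise lattices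
`Λ_b = GaGmEE.lat L L' b` (`TwoCurveTheta.lean`, laws from `TwoCurveThetaLaws.lean`).

## What is proved here (everything; no `sorry`, no new `def … : Prop`)

* chart identities (`thetaPnone_update`, `thetaPnone_mul_prod_eq`, `prod_prod_erase_eq_pow`,
  `thetaPnone_cubic` with `g₂(Λ_b), g₃(Λ_b)`, `thetaPsome_mul_sub` with `zpVal` of `Λ_b`);
* `relSet`, `tangentAt` (Zariski tangent spaces of the cone `ℂ·Θ(V)`), `tangentAt_smul`,
  `card_le_finrank_span_grad_add`, `exists_relations_of_finrank_tangentAt_le`;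
* transport along the group by the composite laws: `clawAt`, `dClawAt`, `clawGF`, `minorRel`,
  `eq_zero_of_dClawAt_eq_zero`, **`finrank_tangentAt_theta_le`** (`dim T(Θ(w)) ≤ dim T(Θ(w+v))`);
* the reference point `refPt` (blockwise reference scalars `z₀(Λ_b)`, `GaGmE.Std.refScalar (lat L L' b)`),
  the relations at it (`segreRel/blockSegreRel/cubicRel (lat L L' b)/fibreRel` are relations),
  `eq_zero_of_mem_tangentAt_refPt` (triangularity), `finrank_tangentAt_refPt_le`,
  **`theta_locRel`** — the Jacobian criterion at every point (field `locRel`);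
* `exists_eval_bdryForm_ne_zero`, `exchangeRel` (+ `_mem_relSet`, exchange forms of `Λ_b`),
  **`theta_surj`, `theta_surj'`** — the image theorem (field `surj`), blocks reconstructed with
  `exists_univExtP_eq_smul (lat L L' b)`.

Generic one-lattice material reused verbatim (`open GaGmE.Std (…)`): `grad`, `rank`, `coordIdx`,
`segreRel`, `blockSegreRel`, `cubicRel`, `fibreRel`, `bdryForm`, `segreRel'`, `swapRel`, `cubicRel'`,
`exchangeForm`, the reference scalars, the monomial gradient pairings, `pderiv_bind₁`,
`sum_mul_eval_pderiv_of_isHomogeneous`, `exists_univExtP_eq_smul`, `PeriodPair.exchange_identity`.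

## References

* Yu. V. Nesterenko, P. Philippon (eds.), *Introduction to Algebraic Independence Theory*,
  LNM 1752, Springer 2001, Ch. 11 (D. Roy), §2.1 (the embedding, boundary), §2.2 (i), Prop. 2.2.
  [NesterenkoPhilippon2001]
* A. Baker, G. Wüstholz, *Logarithmic Forms and Diophantine Geometry*, CUP 2007, §6.9.
  [BakerWustholz2007]
* E. T. Whittaker, G. N. Watson, *A Course of Modern Analysis*, 4th ed., CUP 1927, §20.22.
  [WhittakerWatson1927]
* A. Huber, G. Wüstholz, *Transcendence and Linear Relations of 1-Periods*, CUP 2022, Thm. 15.3.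
  [HuberWustholz2022]
-/

noncomputable section

open Complex MvPolynomial Set Module
open scoped PeriodPair

namespace Literature.NumberTheory.Transcendental

namespace GaGmEE

namespace Std

open GaGmE (Kbar)
open GaGmE.Std (iy iz is coords coords_iy coords_iz coords_is ThetaIdx thetaT thetaT_none thetaT_some
  thetaT_add differentiable_thetaT differentiable_finset_prod clawPt clawPt_iz nClaw
  grad grad_apply grad_smul eval_pderiv_X sum_grad_X sum_grad_X_mul_X sum_grad_X_mul_X_sq
  sum_grad_eq_zero_of_mem_supported X_mem_supported_of_mem C_mem_supported univExtZ_mul_univExtP_zero_sub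
  univExtP_cubic exists_refScalar refScalar refScalar_notMem two_mul_refScalar_notMem
  univExtP_zero_refScalar_ne_zero univExtP_two_refScalar_ne_zero coordIdx rank rank_none_none_le rank_single_le
  rank_update_zero_lt coordIdx_injective card_coords_le segreRel blockSegreRel cubicRel fibreRel bdryForm
  bdryForm_isHomogeneous eval_bdryForm segreRel' swapRel cubicRel' exchangeForm exchangeForm_isHomogeneous)

variable {β γ γ' δ : Type} [Fintype β] [Fintype γ] [Fintype γ'] [Fintype δ] [DecidableEq γ] [DecidableEq γ']
variable (L L' : PeriodPair) (κM : δ → γ ⊕ γ' → Kbar)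

/-! ## Chart identities (port of `PkappaThetaChartIdentities.lean`) -/



/-! ### One block modified -/

omit [Fintype β] [Fintype δ] in
/-- **`Θ^P_{(M[b↦i],none)} = P_i(z'_b) · ∏_{b'≠b} P_{M b'}(z'_{b'})`.** [folklore] -/
theorem thetaPnone_update (M : γ ⊕ γ' → Fin 3) (b : γ ⊕ γ') (i : Fin 3) (w : β ⊕ ((γ ⊕ γ') ⊕ δ) → ℂ) :
    thetaPnone (δ := δ) L L' (Function.update M b i) w =
      (lat L L' b).univExtP i (w (iz b)) * ∏ b' ∈ Finset.univ.erase b, (lat L L' b').univExtP (M b') (w (iz b')) := by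
  unfold thetaPnone
  rw [← Finset.mul_prod_erase Finset.univ _ (Finset.mem_univ b), Function.update_self]
  congr 1
  exact Finset.prod_congr rfl fun b' hb' => by rw [Function.update_of_ne (Finset.ne_of_mem_erase hb')]

omit [Fintype β] [Fintype δ] in
/-- `Θ^P_{(M,none)} = P_{M b}(z'_b) · ∏_{b'≠b} P_{M b'}`. [folklore] -/
theorem thetaPnone_eq_mul_erase (M : γ ⊕ γ' → Fin 3) (b : γ ⊕ γ') (w : β ⊕ ((γ ⊕ γ') ⊕ δ) → ℂ) :
    thetaPnone (δ := δ) L L' M w = (lat L L' b).univExtP (M b) (w (iz b)) * ∏ b' ∈ Finset.univ.erase b, (lat L L' b').univExtP (M b') (w (iz b')) := by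
  unfold thetaPnone
  rw [← Finset.mul_prod_erase Finset.univ _ (Finset.mem_univ b)]

/-! ### The product relation -/

omit [Fintype β] [Fintype δ] in
/-- **Product relation**: `Θ^P_{(M,none)} · ∏_b ∏_{b'≠b} P_{M_c b'} = ∏_b Θ^P_{(M_c[b ↦ M b],none)}`.
[folklore] -/
theorem thetaPnone_mul_prod_eq (M Mc : γ ⊕ γ' → Fin 3) (w : β ⊕ ((γ ⊕ γ') ⊕ δ) → ℂ) :
    thetaPnone (δ := δ) L L' M w * ∏ b, ∏ b' ∈ Finset.univ.erase b, (lat L L' b').univExtP (Mc b') (w (iz b')) =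
      ∏ b, thetaPnone (δ := δ) L L' (Function.update Mc b (M b)) w := by
  simp_rw [thetaPnone_update]
  rw [Finset.prod_mul_distrib]
  rfl

omit [Fintype β] [Fintype δ] in
/-- The double product is a power of the chart function: `∏_b ∏_{b'≠b} P_{M_c b'} = (Θ^P_{(M_c,none)})^{|γ|-1}`.
[folklore] -/
theorem prod_prod_erase_eq_pow (Mc : γ ⊕ γ' → Fin 3) (w : β ⊕ ((γ ⊕ γ') ⊕ δ) → ℂ) :
    ∏ b, ∏ b' ∈ Finset.univ.erase b, (lat L L' b').univExtP (Mc b') (w (iz b')) =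
      thetaPnone (δ := δ) L L' Mc w ^ (Fintype.card (γ ⊕ γ') - 1) := by
  classical
  unfold thetaPnone
  rw [Finset.prod_comm' (t' := Finset.univ) (s' := fun b' => Finset.univ.erase b')
    (h := fun b b' => by simp [Finset.mem_erase, eq_comm])]
  rw [← Finset.prod_pow]
  refine Finset.prod_congr rfl fun b' _ => ?_
  rw [Finset.prod_const, Finset.card_erase_of_mem (Finset.mem_univ _), Finset.card_univ]

/-! ### The block cubic in a chart -/

omit [Fintype β] [Fintype δ] in
/-- **The Weierstrass cubic among `Θ^P_{(M_c[b↦i],none)}`, `i = 0, 1, 2`.**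
[cite: WhittakerWatson1927, §20.22] -/
theorem thetaPnone_cubic (Mc : γ ⊕ γ' → Fin 3) (b : γ ⊕ γ') (w : β ⊕ ((γ ⊕ γ') ⊕ δ) → ℂ) :
    thetaPnone (δ := δ) L L' (Function.update Mc b 2) w ^ 2 * thetaPnone (δ := δ) L L' (Function.update Mc b 0) w =
      4 * thetaPnone (δ := δ) L L' (Function.update Mc b 1) w ^ 3 -
        (lat L L' b).g₂ * thetaPnone (δ := δ) L L' (Function.update Mc b 1) w * thetaPnone (δ := δ) L L' (Function.update Mc b 0) w ^ 2 -
        (lat L L' b).g₃ * thetaPnone (δ := δ) L L' (Function.update Mc b 0) w ^ 3 := by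
  simp only [thetaPnone_update]
  have h := (lat L L' b).univExtP_cubic (w (iz b))
  set C := ∏ b' ∈ Finset.univ.erase b, (lat L L' b').univExtP (Mc b') (w (iz b'))
  linear_combination C ^ 3 * h

/-! ### The fibre relation -/

omit [Fintype β] [Fintype δ] in
/-- **Fibre relation**:
`Θ^P_{(M,e)} Θ^P_{(M_c,none)} - Θ^P_{(M_c,e)} Θ^P_{(M,none)} = -∑_b κ_{eb} (Z_{Mb}P_{M_c b} - Z_{M_c b}P_{Mb})(z'_b) ∏_{b'≠b} P_{M b'} P_{M_c b'}`
(the `s_e`-terms cancel). [folklore] -/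
theorem thetaPsome_mul_sub (M Mc : γ ⊕ γ' → Fin 3) (e : δ) (w : β ⊕ ((γ ⊕ γ') ⊕ δ) → ℂ) :
    thetaPsome L L' κM M e w * thetaPnone (δ := δ) L L' Mc w - thetaPsome L L' κM Mc e w * thetaPnone (δ := δ) L L' M w =
      -∑ b, (κM e b : ℂ) * ((lat L L' b).zpVal (M b) (Mc b) (w (iz b)) *
        ∏ b' ∈ Finset.univ.erase b, ((lat L L' b').univExtP (M b') (w (iz b')) * (lat L L' b').univExtP (Mc b') (w (iz b')))) := by
  unfold thetaPsome
  have hM : ∀ b, thetaPnone (δ := δ) L L' M w =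
      (lat L L' b).univExtP (M b) (w (iz b)) * ∏ b' ∈ Finset.univ.erase b, (lat L L' b').univExtP (M b') (w (iz b')) :=
    fun b => thetaPnone_eq_mul_erase L L' M b w
  have hMc : ∀ b, thetaPnone (δ := δ) L L' Mc w =
      (lat L L' b).univExtP (Mc b) (w (iz b)) * ∏ b' ∈ Finset.univ.erase b, (lat L L' b').univExtP (Mc b') (w (iz b')) :=
    fun b => thetaPnone_eq_mul_erase L L' Mc b w
  -- expand and match the sums termwise
  have key : ∀ b, (κM e b : ℂ) * ((lat L L' b).univExtZ (M b) (w (iz b)) * ∏ b' ∈ Finset.univ.erase b, (lat L L' b').univExtP (M b') (w (iz b'))) *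
        thetaPnone (δ := δ) L L' Mc w -
      (κM e b : ℂ) * ((lat L L' b).univExtZ (Mc b) (w (iz b)) * ∏ b' ∈ Finset.univ.erase b, (lat L L' b').univExtP (Mc b') (w (iz b'))) *
        thetaPnone (δ := δ) L L' M w =
      (κM e b : ℂ) * ((lat L L' b).zpVal (M b) (Mc b) (w (iz b)) *
        ∏ b' ∈ Finset.univ.erase b, ((lat L L' b').univExtP (M b') (w (iz b')) * (lat L L' b').univExtP (Mc b') (w (iz b')))) := by
    intro b
    rw [hMc b, hM b, Finset.prod_mul_distrib, PeriodPair.zpVal]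
    ring
  calc _ = -(∑ b, ((κM e b : ℂ) * ((lat L L' b).univExtZ (M b) (w (iz b)) * ∏ b' ∈ Finset.univ.erase b, (lat L L' b').univExtP (M b') (w (iz b'))) *
              thetaPnone (δ := δ) L L' Mc w -
            (κM e b : ℂ) * ((lat L L' b).univExtZ (Mc b) (w (iz b)) * ∏ b' ∈ Finset.univ.erase b, (lat L L' b').univExtP (Mc b') (w (iz b'))) *
              thetaPnone (δ := δ) L L' M w)) := by
          rw [Finset.sum_sub_distrib, ← Finset.sum_mul, ← Finset.sum_mul]; ring
    _ = _ := by rw [Finset.sum_congr rfl fun b _ => key b]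



/-! ## The cone, its tangent spaces, the Jacobian criterion and the image theorem (port of `PkappaThetaTangent.lean`) -/



/-! ### Relations and Zariski tangent spaces of the theta cone -/

/-- **The homogeneous relations of the theta model**: forms `P` with `F_P = P(Θ) ≡ 0` on
`Lie M_κ,ℂ` (the homogeneous elements of Roy's `𝔊 = 𝔍(G)`). [cite: NesterenkoPhilippon2001, Ch. 11 §2.2] -/
def relSet : Set (MvPolynomial (Option β × ThetaIdx (γ ⊕ γ') δ) ℂ) :=
  {P | (∃ d, P.IsHomogeneous d) ∧ ∀ w, thetaEval L L' κM P w = 0}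

omit [Fintype β] [Fintype δ] in
/-- Membership in `relSet`. [folklore] -/
theorem mem_relSet_iff {P : MvPolynomial (Option β × ThetaIdx (γ ⊕ γ') δ) ℂ} :
    P ∈ relSet L L' κM ↔ (∃ d, P.IsHomogeneous d) ∧ ∀ w, thetaEval L L' κM P w = 0 := Iff.rfl

/-- **The Zariski tangent space of the theta cone at `a ∈ ℂ^{N+1}`**: the vectors `v` with
`∑_J (∂_J P)(a) v_J = 0` for every homogeneous relation `P`. [cite: NesterenkoPhilippon2001, Ch. 11 §2.2 (i)] -/
def tangentAt (a : Option β × ThetaIdx (γ ⊕ γ') δ → ℂ) : Submodule ℂ (Option β × ThetaIdx (γ ⊕ γ') δ → ℂ) where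
  carrier := {v | ∀ P ∈ relSet L L' κM, ∑ J, grad a P J * v J = 0}
  zero_mem' := fun P _ => by simp
  add_mem' := by
    intro v v' hv hv' P hP
    simp only [Pi.add_apply, mul_add, Finset.sum_add_distrib, hv P hP, hv' P hP, add_zero]
  smul_mem' := by
    intro c v hv P hP
    simp only [Pi.smul_apply, smul_eq_mul, mul_left_comm _ c, ← Finset.mul_sum, hv P hP, mul_zero]

/-- Membership in the tangent space. [folklore] -/
theorem mem_tangentAt_iff {a v : Option β × ThetaIdx (γ ⊕ γ') δ → ℂ} :
    v ∈ tangentAt L L' κM a ↔ ∀ P ∈ relSet L L' κM, ∑ J, grad a P J * v J = 0 := Iff.rfl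

/-- **The tangent space of the cone is constant along rays**: `T(c·a) = T(a)` for `c ≠ 0`.
[folklore] -/
theorem tangentAt_smul {c : ℂ} (hc : c ≠ 0) (a : Option β × ThetaIdx (γ ⊕ γ') δ → ℂ) :
    tangentAt L L' κM (c • a) = tangentAt L L' κM a := by
  ext v
  simp only [mem_tangentAt_iff]
  refine forall₂_congr fun P hP => ?_
  obtain ⟨⟨d, hd⟩, -⟩ := hP
  simp only [grad_smul hd, Pi.smul_apply, smul_eq_mul, mul_assoc, ← Finset.mul_sum,
    mul_eq_zero, pow_eq_zero_iff', hc, ne_eq, false_and, false_or]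

/-! ### From a bound on the tangent space to independent relations -/

/-- **Duality count**: the span of the gradients of the relations at `a` has dimension at least
`(N + 1) - dim T(a)`. [folklore] -/
theorem card_le_finrank_span_grad_add (a : Option β × ThetaIdx (γ ⊕ γ') δ → ℂ) :
    Fintype.card (Option β × ThetaIdx (γ ⊕ γ') δ) ≤
      finrank ℂ (Submodule.span ℂ (grad a '' relSet L L' κM)) + finrank ℂ (tangentAt L L' κM a) := by
  set Gr := Submodule.span ℂ (grad a '' relSet L L' κM) with hGr
  -- the pairing `v ↦ (g ↦ ∑ g_J v_J)` restricted to `Gr`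
  let B : (Option β × ThetaIdx (γ ⊕ γ') δ → ℂ) →ₗ[ℂ] (Option β × ThetaIdx (γ ⊕ γ') δ → ℂ) →ₗ[ℂ] ℂ :=
    LinearMap.mk₂ ℂ (fun v g => ∑ J, g J * v J)
      (fun v v' g => by simp only [Pi.add_apply, mul_add, Finset.sum_add_distrib])
      (fun c v g => by
        simp only [Pi.smul_apply, smul_eq_mul, Finset.mul_sum]
        exact Finset.sum_congr rfl fun J _ => by ring)
      (fun v g g' => by simp only [Pi.add_apply, add_mul, Finset.sum_add_distrib])
      (fun c v g => by
        simp only [Pi.smul_apply, smul_eq_mul, Finset.mul_sum]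
        exact Finset.sum_congr rfl fun J _ => by ring)
  let ψ : (Option β × ThetaIdx (γ ⊕ γ') δ → ℂ) →ₗ[ℂ] Module.Dual ℂ Gr := (LinearMap.domRestrict' Gr).comp B
  have hker : LinearMap.ker ψ = tangentAt L L' κM a := by
    ext v
    simp only [LinearMap.mem_ker, mem_tangentAt_iff]
    constructor
    · intro h P hP
      have hg : grad a P ∈ Gr := Submodule.subset_span ⟨P, hP, rfl⟩
      have := LinearMap.congr_fun h ⟨grad a P, hg⟩
      simpa [ψ, B] using this
    · intro h
      apply LinearMap.ext
      rintro ⟨g, hg⟩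
      simp only [ψ, B, LinearMap.coe_comp, Function.comp_apply, LinearMap.domRestrict'_apply,
        LinearMap.mk₂_apply, LinearMap.zero_apply]
      -- `g ↦ ∑ g_J v_J` vanishes on the generators, hence on the span
      have hle : Gr ≤ LinearMap.ker (B v) := by
        rw [hGr, Submodule.span_le]
        rintro _ ⟨P, hP, rfl⟩
        simpa [B] using h P hP
      simpa [B] using hle hg
  have hrn := LinearMap.finrank_range_add_finrank_ker ψ
  rw [hker, Module.finrank_fintype_fun_eq_card] at hrn
  have hrange : finrank ℂ (LinearMap.range ψ) ≤ finrank ℂ Gr :=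
    (Submodule.finrank_le _).trans (Subspace.dual_finrank_eq (K := ℂ) (V := Gr)).le
  omega

/-- **Extraction of independent relations.** If `dim T(a) + m ≤ N + 1`, there are `m` relations
whose gradients at `a` are linearly independent. [folklore] -/
theorem exists_relations_of_finrank_tangentAt_le (a : Option β × ThetaIdx (γ ⊕ γ') δ → ℂ) {m : ℕ}
    (h : finrank ℂ (tangentAt L L' κM a) + m ≤ Fintype.card (Option β × ThetaIdx (γ ⊕ γ') δ)) :
    ∃ S : Finset (MvPolynomial (Option β × ThetaIdx (γ ⊕ γ') δ) ℂ), (∀ P ∈ S, P ∈ relSet L L' κM) ∧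
      S.card = m ∧ LinearIndependent ℂ fun P : S => grad a P.1 := by
  classical
  -- an independent spanning subfamily of the gradients
  obtain ⟨κ, ι, hι, hspan, hli⟩ :=
    exists_linearIndependent' (K := ℂ) (fun P : relSet L L' κM => grad a P.1)
  haveI : Finite κ := hli.finite
  letI : Fintype κ := Fintype.ofFinite κ
  have hcard : m ≤ Fintype.card κ := by
    have h1 := card_le_finrank_span_grad_add L L' κM a
    have h2 : finrank ℂ (Submodule.span ℂ (grad a '' relSet L L' κM)) = Fintype.card κ := by
      rw [Set.image_eq_range, ← hspan]
      exact finrank_span_eq_card hli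
    omega
  -- `m` of them
  let e : Fin m ↪ κ := (Fin.castLEEmb hcard).trans (Fintype.equivFin κ).symm.toEmbedding
  let sel : Fin m → MvPolynomial (Option β × ThetaIdx (γ ⊕ γ') δ) ℂ := fun i => (ι (e i)).1
  have hsel : Function.Injective sel := by
    intro i j hij
    exact e.injective (hι (Subtype.val_injective hij))
  refine ⟨Finset.univ.image sel, ?_, ?_, ?_⟩
  · intro P hP
    obtain ⟨i, -, rfl⟩ := Finset.mem_image.mp hP
    exact (ι (e i)).2
  · rw [Finset.card_image_of_injective _ hsel, Finset.card_univ, Fintype.card_fin]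
  · -- the family over the image is the independent family `grad ∘ ι ∘ e` reindexed by a bijection
    have hli' : LinearIndependent ℂ fun i : Fin m => grad a (sel i) :=
      (hli.comp e e.injective)
    let f : {P // P ∈ Finset.univ.image sel} → Fin m := fun P =>
      (Finset.mem_image.mp P.2).choose
    have hf : ∀ P : {P // P ∈ Finset.univ.image sel}, sel (f P) = P.1 := fun P =>
      (Finset.mem_image.mp P.2).choose_spec.2
    have hfinj : Function.Injective f := by
      intro P Q hPQ
      apply Subtype.ext
      rw [← hf P, ← hf Q, hPQ]
    have := hli'.comp f hfinj
    rwa [show ((fun i : Fin m => grad a (sel i)) ∘ f) =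
        fun P : {P // P ∈ Finset.univ.image sel} => grad a P.1 from
      funext fun P => by simp only [Function.comp_apply, hf]] at this

/-! ### The points `Θ(w)` of the cone -/

/-- The point `Θ(w) ∈ ℂ^{N+1}`. [folklore] -/
def thetaVec (w : β ⊕ ((γ ⊕ γ') ⊕ δ) → ℂ) : Option β × ThetaIdx (γ ⊕ γ') δ → ℂ := fun J => theta L L' κM J w

omit [Fintype β] [Fintype δ] in
/-- Components of `Θ(w)`. [folklore] -/
@[simp] theorem thetaVec_apply (w : β ⊕ ((γ ⊕ γ') ⊕ δ) → ℂ) (J : Option β × ThetaIdx (γ ⊕ γ') δ) :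
    thetaVec L L' κM w J = theta L L' κM J w := rfl

omit [Fintype β] [Fintype δ] in
/-- `F_P(w) = P(Θ(w))`. [folklore] -/
theorem thetaEval_eq_eval_thetaVec (P : MvPolynomial (Option β × ThetaIdx (γ ⊕ γ') δ) ℂ) (w : β ⊕ ((γ ⊕ γ') ⊕ δ) → ℂ) :
    thetaEval L L' κM P w = eval (thetaVec L L' κM w) P := rfl

omit [Fintype β] [Fintype δ] in
/-- `Θ(w) ≠ 0`. [folklore] -/
theorem thetaVec_ne_zero (w : β ⊕ ((γ ⊕ γ') ⊕ δ) → ℂ) : thetaVec L L' κM w ≠ 0 := by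
  obtain ⟨J, hJ⟩ := exists_theta_ne_zero L L' κM w
  exact fun h => hJ (by simpa using congr_fun h J)

omit [Fintype β] [Fintype δ] in
/-- `Θ_{(none, I)} = Θ^P_I` (the torus coordinate `T_none = 1`). [folklore] -/
theorem theta_none_eq (I : ThetaIdx (γ ⊕ γ') δ) (w : β ⊕ ((γ ⊕ γ') ⊕ δ) → ℂ) :
    theta L L' κM (none, I) w = thetaP (β := β) L L' κM I w := by
  simp [theta]

/-! ### The polynomial self-maps of the cone given by the addition laws -/

/-- **`F_{s,v}`: the composite law specialised at `Θ(v)` in its second argument**,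
`F_{s,v,I}(X) = A^{(s)}_I(X, Θ(v)) ∈ ℂ[X]₄`. [cite: NesterenkoPhilippon2001, Ch. 11 §2.1 (84)] -/
def clawAt (s v : β ⊕ ((γ ⊕ γ') ⊕ δ) → ℂ) (I : Option β × ThetaIdx (γ ⊕ γ') δ) :
    MvPolynomial (Option β × ThetaIdx (γ ⊕ γ') δ) ℂ :=
  bind₁ (Sum.elim X fun J => C (theta L L' κM J v)) (claw L L' κM s I)

omit [Fintype β] [Fintype δ] in
/-- Evaluation of `F_{s,v,I}`. [folklore] -/
theorem eval_clawAt (s v : β ⊕ ((γ ⊕ γ') ⊕ δ) → ℂ) (I : Option β × ThetaIdx (γ ⊕ γ') δ)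
    (a : Option β × ThetaIdx (γ ⊕ γ') δ → ℂ) :
    eval a (clawAt L L' κM s v I) = eval (Sum.elim a fun J => theta L L' κM J v) (claw L L' κM s I) := by
  rw [clawAt, eval_bind₁]
  have hfun : (fun i => eval a (Sum.elim X (fun J => C (theta L L' κM J v)) i)) =
      Sum.elim a fun J => theta L L' κM J v := by
    funext K
    rcases K with K | K <;> simp
  rw [hfun]

omit [Fintype β] [Fintype δ] in
/-- **`F_{s,v}(Θ(w)) = U_s(w, v) Θ(w + v)`.** [cite: NesterenkoPhilippon2001, Ch. 11 §2.1 (84)] -/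
theorem eval_clawAt_thetaVec (s v : β ⊕ ((γ ⊕ γ') ⊕ δ) → ℂ) (I : Option β × ThetaIdx (γ ⊕ γ') δ) (w : β ⊕ ((γ ⊕ γ') ⊕ δ) → ℂ) :
    eval (thetaVec L L' κM w) (clawAt L L' κM s v I) =
      clawUnit (β := β) (δ := δ) L L' s w v * theta L L' κM I (w + v) := by
  rw [eval_clawAt]
  exact eval_claw L L' κM s I w v

omit [Fintype β] [Fintype δ] in
/-- `F_{s,v,I}` is a form of degree `4`. [folklore] -/
theorem clawAt_isHomogeneous (s v : β ⊕ ((γ ⊕ γ') ⊕ δ) → ℂ) (I : Option β × ThetaIdx (γ ⊕ γ') δ) :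
    (clawAt L L' κM s v I).IsHomogeneous 4 := by
  classical
  rw [clawAt, ← aeval_eq_bind₁, MvPolynomial.aeval_def, MvPolynomial.eval₂_eq]
  refine IsHomogeneous.sum _ _ _ fun m hm => ?_
  set wt : (Option β × ThetaIdx (γ ⊕ γ') δ) ⊕ (Option β × ThetaIdx (γ ⊕ γ') δ) → ℕ :=
    Sum.elim (fun _ => 1) (fun _ => 0) with hwt
  have hdeg : ∑ i ∈ m.support, wt i * m i = 4 := by
    have h := claw_isWeightedHomogeneous L L' κM s I (mem_support_iff.mp hm)
    rw [Finsupp.weight_apply, Finsupp.sum] at h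
    rw [← h]
    exact Finset.sum_congr rfl fun i _ => by rw [smul_eq_mul, mul_comm]
  have hfac : ∀ i, ((Sum.elim X fun J => C (theta L L' κM J v)) i ^ m i :
      MvPolynomial (Option β × ThetaIdx (γ ⊕ γ') δ) ℂ).IsHomogeneous (wt i * m i) := by
    rintro (J | J)
    · simpa [hwt] using isHomogeneous_X_pow (R := ℂ) (σ := Option β × ThetaIdx (γ ⊕ γ') δ) J (m (Sum.inl J))
    · simpa [hwt] using (isHomogeneous_C (Option β × ThetaIdx (γ ⊕ γ') δ) (theta L L' κM J v)).pow (m (Sum.inr J))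
  have hprod := IsHomogeneous.prod m.support
    (fun i => ((Sum.elim X fun J => C (theta L L' κM J v)) i ^ m i : MvPolynomial (Option β × ThetaIdx (γ ⊕ γ') δ) ℂ))
    (fun i => wt i * m i) fun i _ => hfac i
  rw [← zero_add 4]
  exact (isHomogeneous_C _ _).mul (hdeg ▸ hprod)

omit [Fintype β] [Fintype δ] in
/-- **Relations pull back to relations** under `F_{s,v}`: `P ∈ relSet ⇒ P(F_{s,v}) ∈ relSet`.
[folklore] -/
theorem bind₁_clawAt_mem_relSet {P : MvPolynomial (Option β × ThetaIdx (γ ⊕ γ') δ) ℂ} (hP : P ∈ relSet L L' κM)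
    (s v : β ⊕ ((γ ⊕ γ') ⊕ δ) → ℂ) : bind₁ (clawAt L L' κM s v) P ∈ relSet L L' κM := by
  obtain ⟨⟨d, hd⟩, hP0⟩ := hP
  refine ⟨⟨4 * d, ?_⟩, fun w => ?_⟩
  · rw [← aeval_eq_bind₁]
    exact hd.aeval _ fun I => clawAt_isHomogeneous L L' κM s v I
  · rw [thetaEval_eq_eval_thetaVec, eval_bind₁]
    have hfun : (fun I => eval (thetaVec L L' κM w) (clawAt L L' κM s v I)) =
        clawUnit (β := β) (δ := δ) L L' s w v • thetaVec L L' κM (w + v) := by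
      funext I
      rw [eval_clawAt_thetaVec]
      rfl
    rw [hfun, eval_smul_of_isHomogeneous hd, ← thetaEval_eq_eval_thetaVec, hP0, mul_zero]

/-- **The formal differential `dF_{s,v}(a)`** of the polynomial map at `a`. [folklore] -/
def dClawAt (s v : β ⊕ ((γ ⊕ γ') ⊕ δ) → ℂ) (a : Option β × ThetaIdx (γ ⊕ γ') δ → ℂ) :
    (Option β × ThetaIdx (γ ⊕ γ') δ → ℂ) →ₗ[ℂ] (Option β × ThetaIdx (γ ⊕ γ') δ → ℂ) where
  toFun x := fun I => ∑ J, eval a (pderiv J (clawAt L L' κM s v I)) * x J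
  map_add' x y := by
    funext I
    simp only [Pi.add_apply, mul_add, Finset.sum_add_distrib]
  map_smul' c x := by
    funext I
    simp only [Pi.smul_apply, smul_eq_mul, RingHom.id_apply, Finset.mul_sum]
    exact Finset.sum_congr rfl fun J _ => by ring

/-- Components of `dF(a) x`. [folklore] -/
theorem dClawAt_apply (s v : β ⊕ ((γ ⊕ γ') ⊕ δ) → ℂ) (a x : Option β × ThetaIdx (γ ⊕ γ') δ → ℂ) (I : Option β × ThetaIdx (γ ⊕ γ') δ) :
    dClawAt L L' κM s v a x I = ∑ J, eval a (pderiv J (clawAt L L' κM s v I)) * x J := rfl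

/-- **`dF` maps the tangent space at `a` into the tangent space at `F(a)`** (chain rule and
pull-back of relations). [folklore] -/
theorem dClawAt_mem_tangentAt (s v : β ⊕ ((γ ⊕ γ') ⊕ δ) → ℂ) {a x : Option β × ThetaIdx (γ ⊕ γ') δ → ℂ}
    (hx : x ∈ tangentAt L L' κM a) :
    dClawAt L L' κM s v a x ∈ tangentAt L L' κM fun I => eval a (clawAt L L' κM s v I) := by
  intro P hP
  have h := hx _ (bind₁_clawAt_mem_relSet L L' κM hP s v)
  simp only [grad_apply, eval_pderiv_bind₁, Finset.sum_mul] at h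
  rw [Finset.sum_comm] at h
  rw [← h]
  refine Finset.sum_congr rfl fun I _ => ?_
  rw [grad_apply, dClawAt_apply, Finset.mul_sum]
  exact Finset.sum_congr rfl fun J _ => by ring

/-! ### The composite `G ∘ F` and its minors -/

/-- **`(G ∘ F)_I`** for `F = F_{s,v}`, `G = F_{s',-v}`: a form of degree `16` with
`(G∘F)(Θ(w')) = φ(w') Θ(w')`. [folklore] -/
def clawGF (s s' v : β ⊕ ((γ ⊕ γ') ⊕ δ) → ℂ) (I : Option β × ThetaIdx (γ ⊕ γ') δ) :
    MvPolynomial (Option β × ThetaIdx (γ ⊕ γ') δ) ℂ :=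
  bind₁ (clawAt L L' κM s v) (clawAt L L' κM s' (-v) I)

/-- The scalar `φ(w') = U_s(w', v)⁴ U_{s'}(w' + v, -v)`. [folklore] -/
def phiFun (s s' v w' : β ⊕ ((γ ⊕ γ') ⊕ δ) → ℂ) : ℂ :=
  clawUnit (β := β) (δ := δ) L L' s w' v ^ 4 * clawUnit (β := β) (δ := δ) L L' s' (w' + v) (-v)

omit [Fintype β] [Fintype δ] in
/-- `(G∘F)_I` is a form of degree `16`. [folklore] -/
theorem clawGF_isHomogeneous (s s' v : β ⊕ ((γ ⊕ γ') ⊕ δ) → ℂ) (I : Option β × ThetaIdx (γ ⊕ γ') δ) :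
    (clawGF L L' κM s s' v I).IsHomogeneous 16 := by
  have h := (clawAt_isHomogeneous L L' κM s' (-v) I).aeval _ fun K => clawAt_isHomogeneous L L' κM s v K
  rw [aeval_eq_bind₁] at h
  simpa [clawGF] using h

omit [Fintype β] [Fintype δ] in
/-- **`(G∘F)(Θ(w')) = φ(w') Θ(w')`** for all `w'`. [folklore] -/
theorem eval_clawGF_thetaVec (s s' v : β ⊕ ((γ ⊕ γ') ⊕ δ) → ℂ) (I : Option β × ThetaIdx (γ ⊕ γ') δ) (w' : β ⊕ ((γ ⊕ γ') ⊕ δ) → ℂ) :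
    eval (thetaVec L L' κM w') (clawGF L L' κM s s' v I) = phiFun (β := β) (δ := δ) L L' s s' v w' * theta L L' κM I w' := by
  rw [clawGF, eval_bind₁]
  have hfun : (fun K => eval (thetaVec L L' κM w') (clawAt L L' κM s v K)) =
      clawUnit (β := β) (δ := δ) L L' s w' v • thetaVec L L' κM (w' + v) := by
    funext K
    rw [eval_clawAt_thetaVec]
    rfl
  rw [hfun, eval_smul_of_isHomogeneous (clawAt_isHomogeneous L L' κM s' (-v) I), eval_clawAt_thetaVec,
    show w' + v + -v = w' by abel, phiFun]
  ring

/-- **The `2 × 2` minors** `(G∘F)_I X_K - (G∘F)_K X_I`. [folklore] -/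
def minorRel (s s' v : β ⊕ ((γ ⊕ γ') ⊕ δ) → ℂ) (I K : Option β × ThetaIdx (γ ⊕ γ') δ) :
    MvPolynomial (Option β × ThetaIdx (γ ⊕ γ') δ) ℂ :=
  clawGF L L' κM s s' v I * X K - clawGF L L' κM s s' v K * X I

omit [Fintype β] [Fintype δ] in
/-- **The minors are relations** (`(G∘F)(Θ(w')) ∥ Θ(w')`). [folklore] -/
theorem minorRel_mem_relSet (s s' v : β ⊕ ((γ ⊕ γ') ⊕ δ) → ℂ) (I K : Option β × ThetaIdx (γ ⊕ γ') δ) :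
    minorRel L L' κM s s' v I K ∈ relSet L L' κM := by
  refine ⟨⟨17, ?_⟩, fun w' => ?_⟩
  · exact ((clawGF_isHomogeneous L L' κM s s' v I).mul (isHomogeneous_X ℂ K)).sub
      ((clawGF_isHomogeneous L L' κM s s' v K).mul (isHomogeneous_X ℂ I))
  · rw [thetaEval_eq_eval_thetaVec]
    simp only [minorRel, map_sub, map_mul, eval_X, eval_clawGF_thetaVec, thetaVec_apply]
    ring

/-! ### Injectivity of `dF` on the tangent space -/

open Classical in
omit [Fintype β] [Fintype δ] in
/-- The gradient of a minor, paired with a vector componentwise. [folklore] -/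
theorem grad_minorRel_mul (s s' v : β ⊕ ((γ ⊕ γ') ⊕ δ) → ℂ) (I K : Option β × ThetaIdx (γ ⊕ γ') δ)
    (p x : Option β × ThetaIdx (γ ⊕ γ') δ → ℂ) (J : Option β × ThetaIdx (γ ⊕ γ') δ) :
    grad p (minorRel L L' κM s s' v I K) J * x J =
      eval p (pderiv J (clawGF L L' κM s s' v I)) * x J * p K +
          eval p (clawGF L L' κM s s' v I) * (if K = J then x J else 0) -
        (eval p (pderiv J (clawGF L L' κM s s' v K)) * x J * p I +
          eval p (clawGF L L' κM s s' v K) * (if I = J then x J else 0)) := by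
  classical
  have hδ : ∀ A : Option β × ThetaIdx (γ ⊕ γ') δ,
      eval p (pderiv J (X A : MvPolynomial (Option β × ThetaIdx (γ ⊕ γ') δ) ℂ)) = if A = J then 1 else 0 := by
    intro A
    rw [pderiv_X]
    by_cases h : A = J
    · subst h; simp
    · simp [h]
  rw [grad_apply, minorRel]
  simp only [map_sub, Derivation.leibniz, smul_eq_mul, map_add, map_mul, eval_X, hδ]
  split_ifs <;> ring

/-- Gradient pairing of a minor with a vector `x`:
`∑_J ∂_J((GF)_I X_K - (GF)_K X_I)(p) x_J = (d(GF)x)_I p_K + (GF)_I(p) x_K - (d(GF)x)_K p_I - (GF)_K(p) x_I`.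
[folklore] -/
theorem sum_grad_minorRel (s s' v : β ⊕ ((γ ⊕ γ') ⊕ δ) → ℂ) (I K : Option β × ThetaIdx (γ ⊕ γ') δ)
    (p x : Option β × ThetaIdx (γ ⊕ γ') δ → ℂ) :
    ∑ J, grad p (minorRel L L' κM s s' v I K) J * x J =
      (∑ J, eval p (pderiv J (clawGF L L' κM s s' v I)) * x J) * p K + eval p (clawGF L L' κM s s' v I) * x K -
        ((∑ J, eval p (pderiv J (clawGF L L' κM s s' v K)) * x J) * p I + eval p (clawGF L L' κM s s' v K) * x I) := by
  classical
  simp only [grad_minorRel_mul, Finset.sum_sub_distrib, Finset.sum_add_distrib, ← Finset.sum_mul,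
    ← Finset.mul_sum, Finset.sum_ite_eq, Finset.mem_univ, if_true]

/-- **Injectivity of `dF` on the tangent space.** If `φ(w) ≠ 0`, a tangent vector `x` at
`p = Θ(w)` with `dF_{s,v}(p) x = 0` vanishes: `d(G∘F)(p) x = 0`, the minors give
`φ(w)(p_I x_K - p_K x_I) = 0`, so `x = t·p`, and Euler's identity `d(G∘F)(p) p = 16 φ(w) p` gives
`t = 0`. [folklore] -/
theorem eq_zero_of_dClawAt_eq_zero (s s' v w : β ⊕ ((γ ⊕ γ') ⊕ δ) → ℂ)
    (hφ : phiFun (β := β) (δ := δ) L L' s s' v w ≠ 0) {x : Option β × ThetaIdx (γ ⊕ γ') δ → ℂ}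
    (hx : x ∈ tangentAt L L' κM (thetaVec L L' κM w)) (h0 : dClawAt L L' κM s v (thetaVec L L' κM w) x = 0) :
    x = 0 := by
  set p := thetaVec L L' κM w with hp
  -- (1) `d(G∘F) x = 0`
  have hdF : ∀ K, ∑ J, eval p (pderiv J (clawAt L L' κM s v K)) * x J = 0 := fun K => by
    simpa [dClawAt_apply] using congr_fun h0 K
  have hGF : ∀ I, ∑ J, eval p (pderiv J (clawGF L L' κM s s' v I)) * x J = 0 := by
    intro I
    calc ∑ J, eval p (pderiv J (clawGF L L' κM s s' v I)) * x J
        = ∑ J, ∑ K, eval (fun K' => eval p (clawAt L L' κM s v K')) (pderiv K (clawAt L L' κM s' (-v) I)) *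
            eval p (pderiv J (clawAt L L' κM s v K)) * x J := by
          refine Finset.sum_congr rfl fun J _ => ?_
          rw [clawGF, eval_pderiv_bind₁, Finset.sum_mul]
      _ = ∑ K, eval (fun K' => eval p (clawAt L L' κM s v K')) (pderiv K (clawAt L L' κM s' (-v) I)) *
            ∑ J, eval p (pderiv J (clawAt L L' κM s v K)) * x J := by
          rw [Finset.sum_comm]
          refine Finset.sum_congr rfl fun K _ => ?_
          rw [Finset.mul_sum]
          exact Finset.sum_congr rfl fun J _ => by ring
      _ = 0 := Finset.sum_eq_zero fun K _ => by rw [hdF K, mul_zero]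
  -- (2) the minors: `φ (p_I x_K - p_K x_I) = 0`
  have hGFp : ∀ I, eval p (clawGF L L' κM s s' v I) = phiFun (β := β) (δ := δ) L L' s s' v w * p I := fun I => by
    rw [hp, eval_clawGF_thetaVec]
    rfl
  have hmin : ∀ I K, phiFun (β := β) (δ := δ) L L' s s' v w * (p I * x K - p K * x I) = 0 := by
    intro I K
    have h := hx _ (minorRel_mem_relSet L L' κM s s' v I K)
    rw [sum_grad_minorRel, hGF I, hGF K, hGFp I, hGFp K] at h
    linear_combination h
  -- (3) `x ∥ p`
  obtain ⟨K₀, hK₀⟩ := exists_theta_ne_zero L L' κM w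
  have hpK₀ : p K₀ ≠ 0 := hK₀
  have hpar : x = (x K₀ / p K₀) • p := by
    funext I
    have h := (mul_eq_zero.mp (hmin I K₀)).resolve_left hφ
    simp only [Pi.smul_apply, smul_eq_mul]
    field_simp
    linear_combination -h
  -- (4) Euler's identity for the form `(G∘F)_{K₀}` of degree `16`
  have hE : ∑ J, eval p (pderiv J (clawGF L L' κM s s' v K₀)) * p J =
      16 * (phiFun (β := β) (δ := δ) L L' s s' v w * p K₀) := by
    have h := sum_mul_eval_pderiv_of_isHomogeneous (clawGF_isHomogeneous L L' κM s s' v K₀) p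
    rw [hGFp K₀] at h
    push_cast at h
    rw [← h]
    exact Finset.sum_congr rfl fun J _ => mul_comm _ _
  have h4 := hGF K₀
  rw [hpar] at h4
  simp only [Pi.smul_apply, smul_eq_mul] at h4
  have h5 : x K₀ / p K₀ * (16 * (phiFun (β := β) (δ := δ) L L' s s' v w * p K₀)) = 0 := by
    rw [← hE, Finset.mul_sum, ← h4]
    exact Finset.sum_congr rfl fun J _ => by ring
  have ht : x K₀ / p K₀ = 0 := by
    refine (mul_eq_zero.mp h5).resolve_right ?_
    exact mul_ne_zero (by norm_num) (mul_ne_zero hφ hpK₀)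
  rw [hpar, ht, zero_smul]

/-- **Transport of the tangent space along the group**: `dim T(Θ(w)) ≤ dim T(Θ(w + v))` for all
`w, v` — the formal differential of a composite law good at `(w, v)` (complete system!) embeds
`T(Θ(w))` into `T(U·Θ(w+v)) = T(Θ(w+v))`. [cite: NesterenkoPhilippon2001, Ch. 11 §2.2 (i)] -/
theorem finrank_tangentAt_theta_le (w v : β ⊕ ((γ ⊕ γ') ⊕ δ) → ℂ) :
    finrank ℂ (tangentAt L L' κM (thetaVec L L' κM w)) ≤ finrank ℂ (tangentAt L L' κM (thetaVec L L' κM (w + v))) := by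
  obtain ⟨i, hi⟩ := exists_clawUnit_clawFamily_ne_zero (β := β) (δ := δ) L L' w v
  obtain ⟨i', hi'⟩ := exists_clawUnit_clawFamily_ne_zero (β := β) (δ := δ) L L' (w + v) (-v)
  have hφ : phiFun (β := β) (δ := δ) L L' (clawFamily (β := β) (δ := δ) L L' i)
      (clawFamily (β := β) (δ := δ) L L' i') v w ≠ 0 :=
    mul_ne_zero (pow_ne_zero _ hi) hi'
  have hF : (fun I => eval (thetaVec L L' κM w) (clawAt L L' κM (clawFamily (β := β) (δ := δ) L L' i) v I)) =
      clawUnit (β := β) (δ := δ) L L' (clawFamily (β := β) (δ := δ) L L' i) w v • thetaVec L L' κM (w + v) := by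
    funext I
    rw [eval_clawAt_thetaVec]
    rfl
  let Φ : tangentAt L L' κM (thetaVec L L' κM w) →ₗ[ℂ] tangentAt L L' κM (thetaVec L L' κM (w + v)) :=
    (dClawAt L L' κM (clawFamily (β := β) (δ := δ) L L' i) v (thetaVec L L' κM w)).restrict fun x hx => by
      have h := dClawAt_mem_tangentAt L L' κM (clawFamily (β := β) (δ := δ) L L' i) v hx
      rwa [hF, tangentAt_smul L L' κM hi] at h
  have hinj : Function.Injective Φ := by
    intro x y hxy
    apply Subtype.ext
    have h : dClawAt L L' κM (clawFamily (β := β) (δ := δ) L L' i) v (thetaVec L L' κM w) (x.1 - y.1) = 0 := by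
      rw [map_sub, sub_eq_zero]
      simpa [Φ, LinearMap.coe_restrict_apply] using congrArg Subtype.val hxy
    exact sub_eq_zero.mp
      (eq_zero_of_dClawAt_eq_zero L L' κM _ _ v w hφ (Submodule.sub_mem _ x.2 y.2) h)
  exact LinearMap.finrank_le_finrank_of_injective hinj

/-- **Monotonicity in the form used below**: `dim T(Θ(w)) ≤ dim T(Θ(w₀))` for every reference
point `w₀`. [folklore] -/
theorem finrank_tangentAt_theta_le' (w w₀ : β ⊕ ((γ ⊕ γ') ⊕ δ) → ℂ) :
    finrank ℂ (tangentAt L L' κM (thetaVec L L' κM w)) ≤ finrank ℂ (tangentAt L L' κM (thetaVec L L' κM w₀)) := by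
  have h := finrank_tangentAt_theta_le L L' κM w (w₀ - w)
  rwa [add_sub_cancel] at h

/-! ### The reference point -/

/-- **The reference point `w₀`**: `y = 0`, `z_b = z₀(Λ_b)` (the reference scalar of the lattice
of the block: `z₀ ∉ Λ_b`, `2z₀ ∉ Λ_b`), `s = 0`. [folklore] -/
def refPt : β ⊕ ((γ ⊕ γ') ⊕ δ) → ℂ := fun k =>
  Sum.elim (fun _ => 0) (Sum.elim (fun b => refScalar (lat L L' b)) fun _ => 0) k

omit [Fintype β] [Fintype γ] [Fintype γ'] [Fintype δ] [DecidableEq γ] [DecidableEq γ'] in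
/-- The `E`-coordinates of `w₀`. [folklore] -/
@[simp] theorem refPt_iz (b : γ ⊕ γ') : refPt (β := β) (δ := δ) L L' (iz b) = refScalar (lat L L' b) := by
  simp [refPt, iz]

omit [Fintype β] [Fintype δ] [DecidableEq γ] [DecidableEq γ'] in
/-- `Θ^P_{(M,none)}(w₀) = ∏_b P_{M_b}(z₀(Λ_b))`. [folklore] -/
theorem thetaPnone_refPt (M : γ ⊕ γ' → Fin 3) :
    thetaPnone (β := β) (δ := δ) L L' M (refPt L L') =
      ∏ b, (lat L L' b).univExtP (M b) (refScalar (lat L L' b)) := by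
  simp [thetaPnone]

omit [Fintype β] [Fintype δ] in
/-- `Θ_{J₀}(w₀) ≠ 0` for `J₀ = (none, (0, none))`. [folklore] -/
theorem theta_baseIdx_refPt_ne_zero :
    theta L L' κM ((none, ((0 : γ ⊕ γ' → Fin 3), none)) : Option β × ThetaIdx (γ ⊕ γ') δ) (refPt L L') ≠ 0 := by
  simp only [theta, thetaT_none, thetaP_none, one_mul, thetaPnone_refPt, Pi.zero_apply]
  exact Finset.prod_ne_zero_iff.mpr fun b _ => univExtP_zero_refScalar_ne_zero (lat L L' b)

omit [Fintype β] [Fintype δ] in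
/-- `Θ_{(none,(2δ_b,none))}(w₀) ≠ 0`. [folklore] -/
theorem theta_single_two_refPt_ne_zero (b : γ ⊕ γ') :
    theta L L' κM ((none, (Pi.single b (2 : Fin 3), none)) : Option β × ThetaIdx (γ ⊕ γ') δ) (refPt L L') ≠ 0 := by
  simp only [theta, thetaT_none, thetaP_none, one_mul, thetaPnone_refPt]
  refine Finset.prod_ne_zero_iff.mpr fun c _ => ?_
  by_cases h : c = b
  · subst h
    rw [Pi.single_eq_same]
    exact univExtP_two_refScalar_ne_zero _
  · rw [Pi.single_eq_of_ne h]
    exact univExtP_zero_refScalar_ne_zero _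

/-! ### The relations at the reference point -/

omit [Fintype β] [Fintype δ] in
/-- Splitting a block product at `b`. [folklore] -/
theorem thetaPnone_eq_mul_prod_erase (N : γ ⊕ γ' → Fin 3) (w : β ⊕ ((γ ⊕ γ') ⊕ δ) → ℂ) (b : γ ⊕ γ') :
    thetaPnone (β := β) (δ := δ) L L' N w =
      (lat L L' b).univExtP (N b) (w (iz b)) * ∏ c ∈ Finset.univ.erase b, (lat L L' c).univExtP (N c) (w (iz c)) := by
  unfold thetaPnone
  exact (Finset.mul_prod_erase _ _ (Finset.mem_univ b)).symm

omit [Fintype β] [Fintype δ] in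
/-- Splitting the block product of a single block. [folklore] -/
theorem thetaPnone_single (w : β ⊕ ((γ ⊕ γ') ⊕ δ) → ℂ) (b : γ ⊕ γ') (i : Fin 3) :
    thetaPnone (β := β) (δ := δ) L L' (Pi.single b i) w =
      (lat L L' b).univExtP i (w (iz b)) * ∏ c ∈ Finset.univ.erase b, (lat L L' c).univExtP 0 (w (iz c)) := by
  rw [thetaPnone_eq_mul_prod_erase L L' _ w b, Pi.single_eq_same]
  congr 1
  exact Finset.prod_congr rfl fun c hc => by rw [Pi.single_eq_of_ne (Finset.ne_of_mem_erase hc)]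

omit [Fintype β] [Fintype δ] in
/-- The Segre relations are relations. [folklore] -/
theorem segreRel_mem_relSet (j : β) (I : ThetaIdx (γ ⊕ γ') δ) : segreRel j I ∈ relSet L L' κM := by
  refine ⟨⟨2, ?_⟩, fun w => ?_⟩
  · unfold segreRel
    have h1 : (X (some j, I) * X (none, (0, none)) : MvPolynomial (Option β × ThetaIdx (γ ⊕ γ') δ) ℂ).IsHomogeneous 2 := by
      simpa using (isHomogeneous_X ℂ _).mul (isHomogeneous_X ℂ _)
    have h2 : (X (some j, ((0 : γ ⊕ γ' → Fin 3), none)) * X (none, I) :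
        MvPolynomial (Option β × ThetaIdx (γ ⊕ γ') δ) ℂ).IsHomogeneous 2 := by
      simpa using (isHomogeneous_X ℂ _).mul (isHomogeneous_X ℂ _)
    exact h1.sub h2
  · simp only [segreRel, thetaEval, map_sub, map_mul, eval_X, theta, thetaT_none, one_mul]
    ring

omit [Fintype β] [Fintype δ] in
/-- The block Segre relations are relations. [folklore] -/
theorem blockSegreRel_mem_relSet (M : γ ⊕ γ' → Fin 3) (b : γ ⊕ γ') :
    blockSegreRel (β := β) (δ := δ) M b ∈ relSet L L' κM := by
  refine ⟨⟨2, ?_⟩, fun w => ?_⟩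
  · unfold blockSegreRel
    have h1 : (X (none, (M, none)) * X (none, (0, none)) : MvPolynomial (Option β × ThetaIdx (γ ⊕ γ') δ) ℂ).IsHomogeneous 2 := by
      simpa using (isHomogeneous_X ℂ _).mul (isHomogeneous_X ℂ _)
    have h2 : (X (none, (Function.update M b 0, none)) * X ((none : Option β), (Pi.single b (M b), (none : Option δ))) :
        MvPolynomial (Option β × ThetaIdx (γ ⊕ γ') δ) ℂ).IsHomogeneous 2 := by
      simpa using (isHomogeneous_X ℂ _).mul (isHomogeneous_X ℂ _)
    exact h1.sub h2
  · simp only [blockSegreRel, thetaEval, map_sub, map_mul, eval_X, theta, thetaT_none, thetaP_none,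
      one_mul, sub_eq_zero]
    unfold thetaPnone
    rw [← Finset.prod_mul_distrib, ← Finset.prod_mul_distrib]
    refine Finset.prod_congr rfl fun c _ => ?_
    by_cases hc : c = b
    · subst hc
      rw [Function.update_self, Pi.single_eq_same, Pi.zero_apply, mul_comm]
    · rw [Function.update_of_ne hc, Pi.single_eq_of_ne hc, Pi.zero_apply]

omit [Fintype β] [Fintype δ] in
/-- The cubic relations are relations. [folklore] -/
theorem cubicRel_mem_relSet (b : γ ⊕ γ') : cubicRel (β := β) (δ := δ) (lat L L' b) b ∈ relSet L L' κM := by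
  refine ⟨⟨3, ?_⟩, fun w => ?_⟩
  · have h1 : (X (none, (0, none)) * X ((none : Option β), (Pi.single b (2 : Fin 3), (none : Option δ))) ^ 2 :
        MvPolynomial (Option β × ThetaIdx (γ ⊕ γ') δ) ℂ).IsHomogeneous 3 := by
      simpa using (isHomogeneous_X ℂ _).mul ((isHomogeneous_X ℂ _).pow 2)
    have h2 : (C 4 * X ((none : Option β), (Pi.single b (1 : Fin 3), (none : Option δ))) ^ 3 :
        MvPolynomial (Option β × ThetaIdx (γ ⊕ γ') δ) ℂ).IsHomogeneous 3 := by
      simpa using ((isHomogeneous_X ℂ _).pow 3).C_mul 4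
    have h3 : (C (lat L L' b).g₂ * X (none, (0, none)) ^ 2 * X ((none : Option β), (Pi.single b (1 : Fin 3), (none : Option δ))) :
        MvPolynomial (Option β × ThetaIdx (γ ⊕ γ') δ) ℂ).IsHomogeneous 3 := by
      simpa [mul_assoc] using (((isHomogeneous_X ℂ _).pow 2).mul (isHomogeneous_X ℂ _)).C_mul (lat L L' b).g₂
    have h4 : (C (lat L L' b).g₃ * X ((none : Option β), ((0 : γ ⊕ γ' → Fin 3), (none : Option δ))) ^ 3 :
        MvPolynomial (Option β × ThetaIdx (γ ⊕ γ') δ) ℂ).IsHomogeneous 3 := by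
      simpa using ((isHomogeneous_X ℂ _).pow 3).C_mul (lat L L' b).g₃
    unfold cubicRel
    exact h1.add ((h2.neg.add h3).add h4)
  · set E := ∏ c ∈ Finset.univ.erase b, (lat L L' c).univExtP 0 (w (iz c)) with hE
    have hJ0 : theta L L' κM ((none, ((0 : γ ⊕ γ' → Fin 3), none)) : Option β × ThetaIdx (γ ⊕ γ') δ) w = (lat L L' b).univExtP 0 (w (iz b)) * E := by
      simp only [theta, thetaT_none, thetaP_none, one_mul]
      exact thetaPnone_eq_mul_prod_erase L L' 0 w b
    have hs : ∀ i : Fin 3, theta L L' κM ((none, (Pi.single b i, none)) : Option β × ThetaIdx (γ ⊕ γ') δ) w = (lat L L' b).univExtP i (w (iz b)) * E := by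
      intro i
      simp only [theta, thetaT_none, thetaP_none, one_mul]
      exact thetaPnone_single L L' w b i
    simp only [cubicRel, thetaEval, map_add, map_neg, map_mul, map_pow, eval_X, eval_C, hJ0, hs]
    have hc := univExtP_cubic (lat L L' b) (w (iz b))
    linear_combination E ^ 3 * hc

omit [Fintype β] [Fintype δ] in
/-- The key identity behind the exchange relations (from `Z_iP₀ - Z₀P_i = [i=2]·2P₁²`). [folklore] -/
theorem fibre_identity (M : γ ⊕ γ' → Fin 3) (e : δ) (w : β ⊕ ((γ ⊕ γ') ⊕ δ) → ℂ) :
    thetaPsome (β := β) L L' κM M e w * thetaPnone (β := β) (δ := δ) L L' 0 w -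
        thetaPsome (β := β) L L' κM 0 e w * thetaPnone (β := β) (δ := δ) L L' M w +
      ∑ b ∈ Finset.univ.filter (fun b => M b = 2), 2 * (κM e b : ℂ) *
        (thetaPnone (β := β) (δ := δ) L L' (Function.update M b 1) w * thetaPnone (β := β) (δ := δ) L L' (Pi.single b 1) w) = 0 := by
  -- the `s`-terms cancel
  have hA : thetaPsome (β := β) L L' κM M e w * thetaPnone (β := β) (δ := δ) L L' 0 w -
      thetaPsome (β := β) L L' κM 0 e w * thetaPnone (β := β) (δ := δ) L L' M w =
      (∑ b, (κM e b : ℂ) * ((lat L L' b).univExtZ ((0 : γ ⊕ γ' → Fin 3) b) (w (iz b)) *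
          ∏ b' ∈ Finset.univ.erase b, (lat L L' b').univExtP ((0 : γ ⊕ γ' → Fin 3) b') (w (iz b')))) * thetaPnone (β := β) (δ := δ) L L' M w -
        (∑ b, (κM e b : ℂ) * ((lat L L' b).univExtZ (M b) (w (iz b)) *
          ∏ b' ∈ Finset.univ.erase b, (lat L L' b').univExtP (M b') (w (iz b')))) * thetaPnone (β := β) (δ := δ) L L' 0 w := by
    unfold thetaPsome
    ring
  rw [hA, Finset.sum_mul, Finset.sum_mul, ← Finset.sum_sub_distrib, Finset.sum_filter, ← Finset.sum_add_distrib]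
  refine Finset.sum_eq_zero fun b _ => ?_
  rw [thetaPnone_eq_mul_prod_erase L L' M w b, thetaPnone_eq_mul_prod_erase L L' 0 w b, thetaPnone_update,
    thetaPnone_single]
  have hex := univExtZ_mul_univExtP_zero_sub (lat L L' b) (M b) (w (iz b))
  simp only [Pi.zero_apply] at hex ⊢
  by_cases h2 : M b = 2
  · rw [if_pos h2] at hex ⊢
    rw [h2] at hex ⊢
    linear_combination (-(κM e b : ℂ)) * (∏ b' ∈ Finset.univ.erase b, (lat L L' b').univExtP 0 (w (iz b'))) *
      (∏ b' ∈ Finset.univ.erase b, (lat L L' b').univExtP (M b') (w (iz b'))) * hex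
  · rw [if_neg h2] at hex ⊢
    linear_combination (-(κM e b : ℂ)) * (∏ b' ∈ Finset.univ.erase b, (lat L L' b').univExtP 0 (w (iz b'))) *
      (∏ b' ∈ Finset.univ.erase b, (lat L L' b').univExtP (M b') (w (iz b'))) * hex

omit [Fintype β] [Fintype δ] in
/-- The exchange relations are relations. [folklore] -/
theorem fibreRel_mem_relSet (M : γ ⊕ γ' → Fin 3) (e : δ) : fibreRel (β := β) κM M e ∈ relSet L L' κM := by
  refine ⟨⟨2, ?_⟩, fun w => ?_⟩
  · have hXX : ∀ (A B : Option β × ThetaIdx (γ ⊕ γ') δ) (c : ℂ),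
        (C c * (X A * X B) : MvPolynomial (Option β × ThetaIdx (γ ⊕ γ') δ) ℂ).IsHomogeneous 2 := by
      intro A B c
      simpa using ((isHomogeneous_X ℂ A).mul (isHomogeneous_X ℂ B)).C_mul c
    have hXX' : ∀ A B : Option β × ThetaIdx (γ ⊕ γ') δ,
        (X A * X B : MvPolynomial (Option β × ThetaIdx (γ ⊕ γ') δ) ℂ).IsHomogeneous 2 := by
      intro A B
      simpa using (isHomogeneous_X ℂ A).mul (isHomogeneous_X ℂ B)
    unfold fibreRel
    exact ((hXX' _ _).sub (hXX' _ _)).add (IsHomogeneous.sum _ _ _ fun b _ => hXX _ _ _)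
  · have h := fibre_identity L L' κM M e w
    have hev : thetaEval L L' κM (fibreRel (β := β) κM M e) w =
        thetaPsome (β := β) L L' κM M e w * thetaPnone (β := β) (δ := δ) L L' 0 w -
            thetaPsome (β := β) L L' κM 0 e w * thetaPnone (β := β) (δ := δ) L L' M w +
          ∑ b ∈ Finset.univ.filter (fun b => M b = 2), 2 * (κM e b : ℂ) *
            (thetaPnone (β := β) (δ := δ) L L' (Function.update M b 1) w *
              thetaPnone (β := β) (δ := δ) L L' (Pi.single b 1) w) := by
      simp only [fibreRel, thetaEval, map_add, map_sub, map_mul, map_sum, eval_X, eval_C, theta_none_eq,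
        thetaP_none, thetaP_some]
    rw [hev, h]

/-! ### The tangent space at the reference point injects into the coordinates -/

/-- **The generic elimination step at `w₀`.** If `v` is tangent at `Θ(w₀)`, vanishes at `J₀` and
on a set `S` of variables, and `X_J X_{J₀} + R` is a relation with `R ∈ ℂ[X_K ; K ∈ S]`, then
`v_J = 0`. [folklore] -/
theorem refPt_step {v : Option β × ThetaIdx (γ ⊕ γ') δ → ℂ}
    (hv : v ∈ tangentAt L L' κM (thetaVec L L' κM (refPt (β := β) (δ := δ) L L')))
    (hvJ₀ : v (none, (0, none)) = 0) {J : Option β × ThetaIdx (γ ⊕ γ') δ}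
    {S : Set (Option β × ThetaIdx (γ ⊕ γ') δ)} (hvS : ∀ K ∈ S, v K = 0)
    {R : MvPolynomial (Option β × ThetaIdx (γ ⊕ γ') δ) ℂ} (hR : R ∈ supported ℂ S)
    (hrel : X J * X (none, (0, none)) + R ∈ relSet L L' κM) : v J = 0 := by
  have hpJ₀ := theta_baseIdx_refPt_ne_zero (β := β) (δ := δ) L L' κM
  have hsum := hv _ hrel
  simp only [grad_apply, map_add] at hsum
  simp only [add_mul, Finset.sum_add_distrib] at hsum
  rw [sum_grad_X_mul_X, sum_grad_eq_zero_of_mem_supported hR _ hvS, hvJ₀] at hsum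
  simp only [mul_zero, add_zero, thetaVec_apply] at hsum
  exact (mul_eq_zero.mp hsum).resolve_left hpJ₀

/-- **The elimination step for `X_{(2δ_b)}`** (the cubic relation; `℘′(z₀) ≠ 0`). [folklore] -/
theorem refPt_cubic_step {v : Option β × ThetaIdx (γ ⊕ γ') δ → ℂ}
    (hv : v ∈ tangentAt L L' κM (thetaVec L L' κM (refPt (β := β) (δ := δ) L L')))
    (hvJ₀ : v (none, (0, none)) = 0) (b : γ ⊕ γ') (hv1 : v (none, (Pi.single b 1, none)) = 0) :
    v (none, (Pi.single b 2, none)) = 0 := by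
  have hpJ₀ := theta_baseIdx_refPt_ne_zero (β := β) (δ := δ) L L' κM
  have hp2 := theta_single_two_refPt_ne_zero (β := β) (δ := δ) L L' κM b
  have hsum := hv _ (cubicRel_mem_relSet (β := β) (δ := δ) L L' κM b)
  set S : Set (Option β × ThetaIdx (γ ⊕ γ') δ) := {(none, (0, none)), (none, (Pi.single b 1, none))} with hS
  have hvS : ∀ K ∈ S, v K = 0 := by
    intro K hK
    simp only [hS, Set.mem_insert_iff, Set.mem_singleton_iff] at hK
    rcases hK with rfl | rfl
    exacts [hvJ₀, hv1]
  have hX1 : (X ((none : Option β), (Pi.single b (1 : Fin 3), (none : Option δ))) :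
      MvPolynomial (Option β × ThetaIdx (γ ⊕ γ') δ) ℂ) ∈ supported ℂ S :=
    X_mem_supported_of_mem (by simp [hS])
  have hX0 : (X ((none : Option β), ((0 : γ ⊕ γ' → Fin 3), (none : Option δ))) :
      MvPolynomial (Option β × ThetaIdx (γ ⊕ γ') δ) ℂ) ∈ supported ℂ S :=
    X_mem_supported_of_mem (by simp [hS])
  have hR : (-(C 4 * X ((none : Option β), (Pi.single b (1 : Fin 3), (none : Option δ))) ^ 3) +
      C (lat L L' b).g₂ * X (none, (0, none)) ^ 2 * X ((none : Option β), (Pi.single b (1 : Fin 3), (none : Option δ))) +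
        C (lat L L' b).g₃ * X ((none : Option β), ((0 : γ ⊕ γ' → Fin 3), (none : Option δ))) ^ 3 :
          MvPolynomial (Option β × ThetaIdx (γ ⊕ γ') δ) ℂ) ∈ supported ℂ S := by
    refine Subalgebra.add_mem _ (Subalgebra.add_mem _ ?_ ?_) ?_
    · exact Subalgebra.neg_mem _ (Subalgebra.mul_mem _ (C_mem_supported _ _) (Subalgebra.pow_mem _ hX1 3))
    · exact Subalgebra.mul_mem _ (Subalgebra.mul_mem _ (C_mem_supported _ _) (Subalgebra.pow_mem _ hX0 2)) hX1
    · exact Subalgebra.mul_mem _ (C_mem_supported _ _) (Subalgebra.pow_mem _ hX0 3)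
  have hrest := sum_grad_eq_zero_of_mem_supported hR (thetaVec L L' κM (refPt (β := β) (δ := δ) L L')) hvS
  simp only [cubicRel, grad_apply, map_add] at hsum
  simp only [map_add] at hrest
  simp only [add_mul, Finset.sum_add_distrib] at hsum hrest
  rw [sum_grad_X_mul_X_sq, hvJ₀, add_assoc, hrest] at hsum
  simp only [mul_zero, zero_add, add_zero, thetaVec_apply] at hsum
  exact (mul_eq_zero.mp hsum).resolve_left (mul_ne_zero (mul_ne_zero two_ne_zero hpJ₀) hp2)

/-- **Triangularity.** A tangent vector at `Θ(w₀)` vanishing on the `n + 1` coordinates vanishes: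
a non-zero component of minimal rank is the leading variable of one of the relations above, whose
other variables are coordinates or of smaller rank. [folklore] -/
theorem eq_zero_of_mem_tangentAt_refPt {v : Option β × ThetaIdx (γ ⊕ γ') δ → ℂ}
    (hv : v ∈ tangentAt L L' κM (thetaVec L L' κM (refPt (β := β) (δ := δ) L L')))
    (h0 : ∀ c, v (coordIdx c) = 0) : v = 0 := by
  classical
  by_contra hne
  have hvJ₀ : v (none, (0, none)) = 0 := h0 none
  -- a non-zero component of minimal rank
  obtain ⟨J, hJ, hmin⟩ : ∃ J, v J ≠ 0 ∧ ∀ K, v K ≠ 0 → rank J ≤ rank K := by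
    have hS : ∃ J, v J ≠ 0 := by
      by_contra h
      push Not at h
      exact hne (funext h)
    obtain ⟨J₁, hJ₁⟩ := hS
    have hne' : (Finset.univ.filter fun K => v K ≠ 0).Nonempty :=
      ⟨J₁, Finset.mem_filter.mpr ⟨Finset.mem_univ _, hJ₁⟩⟩
    obtain ⟨J, hJm, hJmin⟩ := Finset.exists_min_image _ (rank (β := β) (γ := γ ⊕ γ') (δ := δ)) hne'
    exact ⟨J, (Finset.mem_filter.mp hJm).2, fun K hK =>
      hJmin K (Finset.mem_filter.mpr ⟨Finset.mem_univ _, hK⟩)⟩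
  -- the "lower" variables, on which `v` vanishes
  let Low : Set (Option β × ThetaIdx (γ ⊕ γ') δ) :=
    {K | K ∈ Set.range (coordIdx (β := β) (γ := γ ⊕ γ') (δ := δ)) ∨ rank K < rank J}
  have hvLow : ∀ K ∈ Low, v K = 0 := by
    rintro K (⟨c, rfl⟩ | hK)
    · exact h0 c
    · by_contra hvK
      exact absurd (hmin K hvK) (not_le.mpr hK)
  have hcoord : ∀ c, coordIdx c ∈ Low := fun c => Or.inl ⟨c, rfl⟩
  obtain ⟨a, M, o⟩ := J
  rcases a with _ | j
  · rcases o with _ | e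
    · -- a block index `(none, (M, none))`
      have hM0 : M ≠ 0 := by
        rintro rfl
        exact hJ (h0 none)
      obtain ⟨b, hb⟩ : ∃ b, M b ≠ 0 := by
        by_contra h
        push Not at h
        exact hM0 (funext h)
      by_cases hsupp : ∀ c, c ≠ b → M c = 0
      · -- a single block: `M = 2δ_b` (as `δ_b` is a coordinate); the cubic relation
        have h1 : M b ≠ 1 := by
          intro h1
          apply hJ
          have hM : M = Pi.single b 1 := by
            funext c
            by_cases hc : c = b
            · subst hc; simpa using h1
            · rw [Pi.single_eq_of_ne hc, hsupp c hc]
          rw [hM]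
          exact h0 (some (Sum.inr (Sum.inl b)))
        have hMb : M b = 2 := by
          revert hb h1
          generalize M b = t
          intro hb h1
          fin_cases t <;> simp_all
        have hM : M = Pi.single b 2 := by
          funext c
          by_cases hc : c = b
          · subst hc; simpa using hMb
          · rw [Pi.single_eq_of_ne hc, hsupp c hc]
        rw [hM] at hJ
        exact hJ (refPt_cubic_step L L' κM hv hvJ₀ b (h0 (some (Sum.inr (Sum.inl b)))))
      · -- at least two blocks: the block Segre relation
        push Not at hsupp
        obtain ⟨c, hcb, hc⟩ := hsupp
        have hrank2 : 2 ≤ rank ((none, (M, none)) : Option β × ThetaIdx (γ ⊕ γ') δ) := by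
          simp only [rank]
          have hsub : ({b, c} : Finset (γ ⊕ γ')) ⊆ Finset.univ.filter fun b' => M b' ≠ 0 := by
            intro x hx
            rw [Finset.mem_insert, Finset.mem_singleton] at hx
            rw [Finset.mem_filter]
            rcases hx with rfl | rfl
            · exact ⟨Finset.mem_univ _, hb⟩
            · exact ⟨Finset.mem_univ _, hc⟩
          have := Finset.card_le_card hsub
          rwa [Finset.card_pair (Ne.symm hcb)] at this
        refine hJ (refPt_step L L' κM hv hvJ₀ hvLow
          (R := -(X ((none : Option β), (Function.update M b 0, (none : Option δ))) *
            X ((none : Option β), (Pi.single b (M b), (none : Option δ))))) ?_ ?_)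
        · refine Subalgebra.neg_mem _ (Subalgebra.mul_mem _ (X_mem_supported_of_mem (Or.inr ?_))
            (X_mem_supported_of_mem (Or.inr ?_)))
          · exact rank_update_zero_lt hb
          · exact (rank_single_le b (M b)).trans_lt hrank2
        · have h := blockSegreRel_mem_relSet (β := β) (δ := δ) L L' κM M b
          rwa [blockSegreRel, sub_eq_add_neg] at h
    · -- a fibre index `(none, (M, some e))`, `M ≠ 0`
      have hM0 : M ≠ 0 := by
        rintro rfl
        exact hJ (h0 (some (Sum.inr (Sum.inr e))))
      have hrankJ : rank ((none, (M, some e)) : Option β × ThetaIdx (γ ⊕ γ') δ) = Fintype.card (γ ⊕ γ') + 1 := rfl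
      refine hJ (refPt_step L L' κM hv hvJ₀ hvLow
        (R := -(X ((none : Option β), ((0 : γ ⊕ γ' → Fin 3), some e)) * X (none, (M, none))) +
          ∑ b ∈ Finset.univ.filter (fun b => M b = 2), C (2 * (κM e b : ℂ)) *
            (X ((none : Option β), (Function.update M b 1, (none : Option δ))) *
              X ((none : Option β), (Pi.single b (1 : Fin 3), (none : Option δ))))) ?_ ?_)
      · refine Subalgebra.add_mem _ (Subalgebra.neg_mem _ (Subalgebra.mul_mem _
          (X_mem_supported_of_mem (hcoord (some (Sum.inr (Sum.inr e)))))
          (X_mem_supported_of_mem (Or.inr ?_)))) (Subalgebra.sum_mem _ fun b _ =>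
            Subalgebra.mul_mem _ (C_mem_supported _ _) (Subalgebra.mul_mem _
              (X_mem_supported_of_mem (Or.inr ?_)) (X_mem_supported_of_mem (hcoord (some (Sum.inr (Sum.inl b)))))))
        · rw [hrankJ]
          exact Nat.lt_succ_of_le (rank_none_none_le M)
        · rw [hrankJ]
          exact Nat.lt_succ_of_le (rank_none_none_le _)
      · have h := fibreRel_mem_relSet (β := β) L L' κM M e
        have heq : (X (none, (M, some e)) * X (none, (0, none)) +
            (-(X ((none : Option β), ((0 : γ ⊕ γ' → Fin 3), some e)) * X (none, (M, none))) +
              ∑ b ∈ Finset.univ.filter (fun b => M b = 2), C (2 * (κM e b : ℂ)) *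
                (X ((none : Option β), (Function.update M b 1, (none : Option δ))) *
                  X ((none : Option β), (Pi.single b (1 : Fin 3), (none : Option δ))))) :
            MvPolynomial (Option β × ThetaIdx (γ ⊕ γ') δ) ℂ) = fibreRel (β := β) κM M e := by
          unfold fibreRel
          ring
        rwa [← heq] at h
  · -- a torus index `(some j, (M, o))` with `(M, o) ≠ (0, none)`: the Segre relation
    have hI : rank ((none, (M, o)) : Option β × ThetaIdx (γ ⊕ γ') δ) <
        rank ((some j, (M, o)) : Option β × ThetaIdx (γ ⊕ γ') δ) := by
      rcases o with _ | e
      · exact Nat.lt_of_le_of_lt (rank_none_none_le M) (by simp [rank])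
      · simp [rank]
    refine hJ (refPt_step L L' κM hv hvJ₀ hvLow
      (R := -(X (some j, ((0 : γ ⊕ γ' → Fin 3), (none : Option δ))) * X (none, (M, o)))) ?_ ?_)
    · exact Subalgebra.neg_mem _ (Subalgebra.mul_mem _ (X_mem_supported_of_mem (hcoord (some (Sum.inl j))))
        (X_mem_supported_of_mem (Or.inr hI)))
    · have h := segreRel_mem_relSet L L' κM j (M, o)
      rwa [segreRel, sub_eq_add_neg] at h

/-- **`dim T(Θ(w₀)) ≤ n + 1`**: the tangent space at the reference point injects into the
coordinates. [folklore] -/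
theorem finrank_tangentAt_refPt_le :
    finrank ℂ (tangentAt L L' κM (thetaVec L L' κM (refPt (β := β) (δ := δ) L L'))) ≤ Fintype.card (β ⊕ ((γ ⊕ γ') ⊕ δ)) + 1 := by
  let r : tangentAt L L' κM (thetaVec L L' κM (refPt (β := β) (δ := δ) L L')) →ₗ[ℂ] (Option (β ⊕ ((γ ⊕ γ') ⊕ δ)) → ℂ) :=
    { toFun := fun x c => x.1 (coordIdx c)
      map_add' := fun x y => rfl
      map_smul' := fun c x => rfl }
  have hinj : Function.Injective r := by
    intro x y hxy
    apply Subtype.ext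
    have h := eq_zero_of_mem_tangentAt_refPt L L' κM (Submodule.sub_mem _ x.2 y.2) fun c => by
      have := congr_fun hxy c
      simpa [r, sub_eq_zero] using this
    exact sub_eq_zero.mp h
  have h := LinearMap.finrank_le_finrank_of_injective hinj
  rwa [Module.finrank_fintype_fun_eq_card, Fintype.card_option] at h

/-- **`dim T(Θ(w)) ≤ n + 1` at every point** (transport + the reference point).
[cite: NesterenkoPhilippon2001, Ch. 11 §2.2 (i)] -/
theorem finrank_tangentAt_thetaVec_le (w : β ⊕ ((γ ⊕ γ') ⊕ δ) → ℂ) :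
    finrank ℂ (tangentAt L L' κM (thetaVec L L' κM w)) ≤ Fintype.card (β ⊕ ((γ ⊕ γ') ⊕ δ)) + 1 :=
  (finrank_tangentAt_theta_le' L L' κM w (refPt (β := β) (δ := δ) L L')).trans (finrank_tangentAt_refPt_le L L' κM)

/-- **The Jacobian criterion for the theta model of `M_κ` (field `locRel` of `AnalyticGroupModel`)**:
at every `w ∈ Lie M_κ,ℂ` there are `N - n` homogeneous relations of the theta functions whose
gradients at `Θ(w)` are linearly independent (`N + 1` = number of theta functions,
`n = dim M_κ`). [cite: NesterenkoPhilippon2001, Ch. 11 §2.2 (i), Prop. 2.2 (proof)] -/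
theorem theta_locRel (w : β ⊕ ((γ ⊕ γ') ⊕ δ) → ℂ) :
    ∃ S : Finset (MvPolynomial (Option β × ThetaIdx (γ ⊕ γ') δ) ℂ),
      (∀ P ∈ S, ∃ d, P.IsHomogeneous d) ∧ (∀ P ∈ S, ∀ w', thetaEval L L' κM P w' = 0) ∧
      S.card + (Fintype.card (β ⊕ ((γ ⊕ γ') ⊕ δ)) + 1) = Fintype.card (Option β × ThetaIdx (γ ⊕ γ') δ) ∧
      LinearIndependent ℂ fun P : S => fun J => thetaEval L L' κM (pderiv J P.1) w := by
  have hle := finrank_tangentAt_thetaVec_le L L' κM w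
  have hc := card_coords_le (β := β) (γ := γ ⊕ γ') (δ := δ)
  obtain ⟨S, hS, hcardS, hli⟩ := exists_relations_of_finrank_tangentAt_le L L' κM (thetaVec L L' κM w)
    (m := Fintype.card (Option β × ThetaIdx (γ ⊕ γ') δ) - (Fintype.card (β ⊕ ((γ ⊕ γ') ⊕ δ)) + 1)) (by omega)
  exact ⟨S, fun P hP => (hS P hP).1, fun P hP => (hS P hP).2, by omega, hli⟩

/-! ### Points of the cone over the Weierstrass cubic -/

/-! ### The boundary forms -/

omit [Fintype β] [Fintype δ] in
/-- **No point of `G` is on the boundary**: at every `w` some boundary form is non-zero at `Θ(w)`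
(the block chart of `w` on every torus index). [folklore] -/
theorem exists_eval_bdryForm_ne_zero [Fintype β] [Fintype δ] (w : β ⊕ ((γ ⊕ γ') ⊕ δ) → ℂ) :
    ∃ M : Option β → (γ ⊕ γ' → Fin 3), eval (thetaVec L L' κM w) (bdryForm (δ := δ) M) ≠ 0 := by
  classical
  -- the block chart of `w`
  let M₀ : γ ⊕ γ' → Fin 3 := fun b => if w (iz b) ∈ (lat L L' b).lattice then 2 else 0
  have hM : ∀ b, (lat L L' b).univExtP (M₀ b) (w (iz b)) ≠ 0 := by
    intro b
    by_cases hb : w (iz b) ∈ (lat L L' b).lattice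
    · obtain ⟨m', n', hmn⟩ := PeriodPair.mem_lattice.mp hb
      obtain ⟨c, hc, -, -, h2, -⟩ := (lat L L' b).exists_univExtTheta_lattice m' n' 0
      simp only [PeriodPair.univExtTheta_inl] at h2
      have : M₀ b = 2 := if_pos hb
      rw [this, ← hmn, h2]
      exact mul_ne_zero hc (by norm_num)
    · have : M₀ b = 0 := if_neg hb
      rw [this, (PeriodPair.univExtP_eq hb).1]
      exact pow_ne_zero _ ((lat L L' b).weierstrassSigma_ne_zero hb)
  refine ⟨fun _ => M₀, ?_⟩
  rw [eval_bdryForm]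
  refine Finset.prod_ne_zero_iff.mpr fun a _ => ?_
  simp only [thetaVec_apply, theta, thetaP_none, thetaPnone]
  refine mul_ne_zero ?_ (Finset.prod_ne_zero_iff.mpr fun b _ => hM b)
  rcases a with _ | j
  · simp
  · simp [Complex.exp_ne_zero]

/-! ### The relations used by the reconstruction -/

omit [Fintype β] [Fintype δ] in
/-- The Segre relations are relations. [folklore] -/
theorem segreRel'_mem_relSet (M0 : γ ⊕ γ' → Fin 3) (a : Option β) (I : ThetaIdx (γ ⊕ γ') δ) :
    segreRel' (β := β) M0 a I ∈ relSet L L' κM := by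
  refine ⟨⟨2, ?_⟩, fun w => ?_⟩
  · unfold segreRel'
    have h1 : (X (a, I) * X (none, (M0, none)) : MvPolynomial (Option β × ThetaIdx (γ ⊕ γ') δ) ℂ).IsHomogeneous 2 := by
      simpa using (isHomogeneous_X ℂ _).mul (isHomogeneous_X ℂ _)
    have h2 : (X (a, (M0, (none : Option δ))) * X (none, I) :
        MvPolynomial (Option β × ThetaIdx (γ ⊕ γ') δ) ℂ).IsHomogeneous 2 := by
      simpa using (isHomogeneous_X ℂ _).mul (isHomogeneous_X ℂ _)
    exact h1.sub h2
  · simp only [segreRel', thetaEval, map_sub, map_mul, eval_X, theta, thetaT_none, one_mul]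
    ring

omit [Fintype β] [Fintype δ] in
/-- The block swap relations are relations. [folklore] -/
theorem swapRel_mem_relSet (Mx M0 : γ ⊕ γ' → Fin 3) (b : γ ⊕ γ') : swapRel (β := β) (δ := δ) Mx M0 b ∈ relSet L L' κM := by
  refine ⟨⟨2, ?_⟩, fun w => ?_⟩
  · unfold swapRel
    have h1 : (X ((none : Option β), (Mx, (none : Option δ))) * X ((none : Option β), (M0, (none : Option δ))) :
        MvPolynomial (Option β × ThetaIdx (γ ⊕ γ') δ) ℂ).IsHomogeneous 2 := by
      simpa using (isHomogeneous_X ℂ _).mul (isHomogeneous_X ℂ _)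
    have h2 : (X ((none : Option β), (Function.update Mx b (M0 b), (none : Option δ))) *
        X ((none : Option β), (Function.update M0 b (Mx b), (none : Option δ))) :
          MvPolynomial (Option β × ThetaIdx (γ ⊕ γ') δ) ℂ).IsHomogeneous 2 := by
      simpa using (isHomogeneous_X ℂ _).mul (isHomogeneous_X ℂ _)
    exact h1.sub h2
  · simp only [swapRel, thetaEval, map_sub, map_mul, eval_X, theta_none_eq, thetaP_none, sub_eq_zero]
    unfold thetaPnone
    rw [← Finset.prod_mul_distrib, ← Finset.prod_mul_distrib]
    refine Finset.prod_congr rfl fun c _ => ?_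
    by_cases hc : c = b
    · subst hc
      rw [Function.update_self, Function.update_self, mul_comm]
    · rw [Function.update_of_ne hc, Function.update_of_ne hc]

omit [Fintype β] [Fintype δ] in
/-- The cubic relations are relations. [folklore] -/
theorem cubicRel'_mem_relSet (M0 : γ ⊕ γ' → Fin 3) (b : γ ⊕ γ') : cubicRel' (β := β) (δ := δ) (lat L L' b) M0 b ∈ relSet L L' κM := by
  refine ⟨⟨3, ?_⟩, fun w => ?_⟩
  · have h1 : (X ((none : Option β), (Function.update M0 b 0, (none : Option δ))) *
        X ((none : Option β), (Function.update M0 b 2, (none : Option δ))) ^ 2 :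
          MvPolynomial (Option β × ThetaIdx (γ ⊕ γ') δ) ℂ).IsHomogeneous 3 := by
      simpa using (isHomogeneous_X ℂ _).mul ((isHomogeneous_X ℂ _).pow 2)
    have h2 : (C 4 * X ((none : Option β), (Function.update M0 b 1, (none : Option δ))) ^ 3 :
        MvPolynomial (Option β × ThetaIdx (γ ⊕ γ') δ) ℂ).IsHomogeneous 3 := by
      simpa using ((isHomogeneous_X ℂ _).pow 3).C_mul 4
    have h3 : (C (lat L L' b).g₂ * X ((none : Option β), (Function.update M0 b 0, (none : Option δ))) ^ 2 *
        X ((none : Option β), (Function.update M0 b 1, (none : Option δ))) :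
          MvPolynomial (Option β × ThetaIdx (γ ⊕ γ') δ) ℂ).IsHomogeneous 3 := by
      simpa [mul_assoc] using (((isHomogeneous_X ℂ _).pow 2).mul (isHomogeneous_X ℂ _)).C_mul (lat L L' b).g₂
    have h4 : (C (lat L L' b).g₃ * X ((none : Option β), (Function.update M0 b 0, (none : Option δ))) ^ 3 :
        MvPolynomial (Option β × ThetaIdx (γ ⊕ γ') δ) ℂ).IsHomogeneous 3 := by
      simpa using ((isHomogeneous_X ℂ _).pow 3).C_mul (lat L L' b).g₃
    unfold cubicRel'
    exact ((h1.sub h2).add h3).add h4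
  · set E := ∏ c ∈ Finset.univ.erase b, (lat L L' c).univExtP (M0 c) (w (iz c)) with hE
    have hs : ∀ i : Fin 3, theta L L' κM ((none, (Function.update M0 b i, none)) : Option β × ThetaIdx (γ ⊕ γ') δ) w =
        (lat L L' b).univExtP i (w (iz b)) * E := by
      intro i
      rw [theta_none_eq, thetaP_none]
      exact thetaPnone_update L L' M0 b i w
    simp only [cubicRel', thetaEval, map_add, map_sub, map_mul, map_pow, eval_X, eval_C, hs]
    have hc := (lat L L' b).univExtP_cubic (w (iz b))
    linear_combination E ^ 3 * hc

omit [Fintype β] [Fintype δ] in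
/-- The value of the exchange form. [folklore] -/
theorem thetaEval_exchangeForm (Mx M0 : γ ⊕ γ' → Fin 3) (b : γ ⊕ γ') (w : β ⊕ ((γ ⊕ γ') ⊕ δ) → ℂ) :
    thetaEval L L' κM (exchangeForm (β := β) (δ := δ) (lat L L' b) Mx M0 b) w =
      ((lat L L' b).univExtZ (Mx b) (w (iz b)) * (lat L L' b).univExtP (M0 b) (w (iz b)) -
          (lat L L' b).univExtZ (M0 b) (w (iz b)) * (lat L L' b).univExtP (Mx b) (w (iz b))) *
        ((∏ c ∈ Finset.univ.erase b, (lat L L' c).univExtP (Mx c) (w (iz c))) *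
          ∏ c ∈ Finset.univ.erase b, (lat L L' c).univExtP (M0 c) (w (iz c))) := by
  have hs : ∀ (N : γ ⊕ γ' → Fin 3) (i : Fin 3),
      theta L L' κM ((none, (Function.update N b i, none)) : Option β × ThetaIdx (γ ⊕ γ') δ) w =
        (lat L L' b).univExtP i (w (iz b)) * ∏ c ∈ Finset.univ.erase b, (lat L L' c).univExtP (N c) (w (iz c)) := by
    intro N i
    rw [theta_none_eq, thetaP_none]
    exact thetaPnone_update L L' N b i w
  rw [(lat L L' b).exchange_identity]
  simp only [exchangeForm, thetaEval, map_add, map_mul, eval_X, eval_C, hs]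
  ring

/-- **The exchange relations of the fibre coordinates** between `Mx` and the chart `M0`:
`X_{(Mx,e)}X_{(M0,∅)} - X_{(M0,e)}X_{(Mx,∅)} + ∑_b κ_{eb} Q_b`. [folklore] -/
def exchangeRel (Mx M0 : γ ⊕ γ' → Fin 3) (e : δ) : MvPolynomial (Option β × ThetaIdx (γ ⊕ γ') δ) ℂ :=
  X ((none : Option β), (Mx, some e)) * X ((none : Option β), (M0, (none : Option δ))) -
      X ((none : Option β), (M0, some e)) * X ((none : Option β), (Mx, (none : Option δ))) +
    ∑ b, C (κM e b : ℂ) * exchangeForm (lat L L' b) Mx M0 b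

omit [Fintype β] [Fintype δ] in
/-- **The exchange relations are relations** (the `s_e`-terms cancel; the `ζ`-terms are the
exchange forms). [folklore] -/
theorem exchangeRel_mem_relSet (Mx M0 : γ ⊕ γ' → Fin 3) (e : δ) :
    exchangeRel (β := β) L L' κM Mx M0 e ∈ relSet L L' κM := by
  refine ⟨⟨2, ?_⟩, fun w => ?_⟩
  · have hXX' : ∀ A B : Option β × ThetaIdx (γ ⊕ γ') δ,
        (X A * X B : MvPolynomial (Option β × ThetaIdx (γ ⊕ γ') δ) ℂ).IsHomogeneous 2 := by
      intro A B
      simpa using (isHomogeneous_X ℂ A).mul (isHomogeneous_X ℂ B)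
    unfold exchangeRel
    refine ((hXX' _ _).sub (hXX' _ _)).add (IsHomogeneous.sum _ _ _ fun b _ => ?_)
    simpa using (exchangeForm_isHomogeneous (lat L L' b) Mx M0 b).C_mul (κM e b : ℂ)
  · have hev : thetaEval L L' κM (exchangeRel (β := β) L L' κM Mx M0 e) w =
        thetaPsome (β := β) L L' κM Mx e w * thetaPnone (β := β) (δ := δ) L L' M0 w -
            thetaPsome (β := β) L L' κM M0 e w * thetaPnone (β := β) (δ := δ) L L' Mx w +
          ∑ b, (κM e b : ℂ) * thetaEval L L' κM (exchangeForm (β := β) (δ := δ) (lat L L' b) Mx M0 b) w := by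
      simp only [exchangeRel, thetaEval, map_add, map_sub, map_mul, map_sum, eval_X, eval_C, theta_none_eq,
        thetaP_none, thetaP_some]
    rw [hev]
    simp only [thetaEval_exchangeForm]
    -- the `s`-terms cancel
    have hA : thetaPsome (β := β) L L' κM Mx e w * thetaPnone (β := β) (δ := δ) L L' M0 w -
        thetaPsome (β := β) L L' κM M0 e w * thetaPnone (β := β) (δ := δ) L L' Mx w =
        (∑ b, (κM e b : ℂ) * ((lat L L' b).univExtZ (M0 b) (w (iz b)) *
            ∏ b' ∈ Finset.univ.erase b, (lat L L' b').univExtP (M0 b') (w (iz b')))) * thetaPnone (β := β) (δ := δ) L L' Mx w -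
          (∑ b, (κM e b : ℂ) * ((lat L L' b).univExtZ (Mx b) (w (iz b)) *
            ∏ b' ∈ Finset.univ.erase b, (lat L L' b').univExtP (Mx b') (w (iz b')))) * thetaPnone (β := β) (δ := δ) L L' M0 w := by
      unfold thetaPsome
      ring
    rw [hA, Finset.sum_mul, Finset.sum_mul, ← Finset.sum_sub_distrib, ← Finset.sum_add_distrib]
    refine Finset.sum_eq_zero fun b _ => ?_
    rw [thetaPnone_eq_mul_prod_erase L L' Mx w b, thetaPnone_eq_mul_prod_erase L L' M0 w b]
    ring

/-! ### The image theorem -/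

omit [Fintype δ] in
/-- **The image theorem (field `surj` of `AnalyticGroupModel`)**: a point `x ∈ ℂ^{N+1}` killing all
homogeneous relations of `Θ` at which some boundary form is non-zero is a point `c · Θ(w)` of the
cone over `Θ(Lie M_κ,ℂ)`. [cite: NesterenkoPhilippon2001, Ch. 11 §2.1, §2.3] -/
theorem theta_surj (x : Option β × ThetaIdx (γ ⊕ γ') δ → ℂ) (hrel : ∀ P ∈ relSet L L' κM, eval x P = 0)
    (hb : ∃ M : Option β → (γ ⊕ γ' → Fin 3), eval x (bdryForm (δ := δ) M) ≠ 0) :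
    ∃ (c : ℂ) (w : β ⊕ ((γ ⊕ γ') ⊕ δ) → ℂ), x = c • thetaVec L L' κM w := by
  classical
  obtain ⟨Mb, hMb⟩ := hb
  rw [eval_bdryForm] at hMb
  have hxa : ∀ a, x (a, (Mb a, none)) ≠ 0 := fun a h =>
    hMb (Finset.prod_eq_zero (Finset.mem_univ a) h)
  -- the chart `M0` of the `P_κ`-part and the base coordinate `x₀ ≠ 0`
  set M0 : γ ⊕ γ' → Fin 3 := Mb none with hM0
  set x₀ : ℂ := x (none, (M0, none)) with hx₀
  have hx₀ne : x₀ ≠ 0 := hxa none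
  -- (1) Segre: `x_{(a,I)} x₀ = t_a p_I`
  have hSegre : ∀ (a : Option β) (I : ThetaIdx (γ ⊕ γ') δ),
      x (a, I) * x₀ = x (a, (M0, none)) * x (none, I) := by
    intro a I
    have h := hrel _ (segreRel'_mem_relSet L L' κM M0 a I)
    simp only [segreRel', map_sub, map_mul, eval_X] at h
    linear_combination h
  have hta : ∀ a, x (a, (M0, none)) ≠ 0 := by
    intro a hta
    apply hxa a
    have h := hSegre a (Mb a, none)
    rw [hta, zero_mul, mul_eq_zero] at h
    exact h.resolve_right hx₀ne
  -- (2) the block vectors `q_b(i) = p_{(M0[b↦i], ∅)}` are on the cubic cone: `q_b = c_b P(z_b)`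
  have hblock : ∀ b, ∃ (z c : ℂ), c ≠ 0 ∧ ∀ i : Fin 3,
      x (none, (Function.update M0 b i, none)) = c * (lat L L' b).univExtP i z := by
    intro b
    refine exists_univExtP_eq_smul (lat L L' b) (fun i => x (none, (Function.update M0 b i, none))) ?_ ?_
    · intro h
      have := congr_fun h (M0 b)
      simp only [Function.update_eq_self, Pi.zero_apply] at this
      exact hx₀ne this
    · have h := hrel _ (cubicRel'_mem_relSet (β := β) (δ := δ) L L' κM M0 b)
      simp only [cubicRel', map_add, map_sub, map_mul, map_pow, eval_X, eval_C] at h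
      linear_combination h
  choose z c hc hq using hblock
  -- the base coordinate on each block
  have hx₀b : ∀ b, x₀ = c b * (lat L L' b).univExtP (M0 b) (z b) := fun b => by
    have := hq b (M0 b)
    rwa [Function.update_eq_self] at this
  have hPb : ∀ b, (lat L L' b).univExtP (M0 b) (z b) ≠ 0 := fun b h =>
    hx₀ne (by rw [hx₀b b, h, mul_zero])
  -- (3) the block part is rank one: `p_{(Mx,∅)} = C · ∏_b P_{Mx_b}(z_b)`
  set Pi0 : ℂ := ∏ b, (lat L L' b).univExtP (M0 b) (z b) with hPi0
  have hPi0ne : Pi0 ≠ 0 := Finset.prod_ne_zero_iff.mpr fun b _ => hPb b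
  set C₀ : ℂ := x₀ / Pi0 with hC₀
  have hC₀ne : C₀ ≠ 0 := div_ne_zero hx₀ne hPi0ne
  have hrank : ∀ (n : ℕ) (Mx : γ ⊕ γ' → Fin 3), (Finset.univ.filter fun b => Mx b ≠ M0 b).card ≤ n →
      x (none, (Mx, none)) = C₀ * ∏ b, (lat L L' b).univExtP (Mx b) (z b) := by
    intro n
    induction n with
    | zero =>
      intro Mx hMx
      have hM : Mx = M0 := by
        funext b
        by_contra h
        have : b ∈ Finset.univ.filter fun b => Mx b ≠ M0 b := Finset.mem_filter.mpr ⟨Finset.mem_univ _, h⟩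
        rw [Nat.le_zero, Finset.card_eq_zero] at hMx
        rw [hMx] at this
        simp at this
      rw [hM, ← hx₀, ← hPi0, hC₀]
      field_simp
    | succ n ih =>
      intro Mx hMx
      by_cases hle : (Finset.univ.filter fun b => Mx b ≠ M0 b).card ≤ n
      · exact ih Mx hle
      · -- pick a block where `Mx` differs from `M0` and swap it
        have hne : (Finset.univ.filter fun b => Mx b ≠ M0 b).Nonempty := by
          rw [← Finset.card_pos]; omega
        obtain ⟨b, hbm⟩ := hne
        have hb : Mx b ≠ M0 b := (Finset.mem_filter.mp hbm).2
        set Mx' := Function.update Mx b (M0 b) with hMx'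
        have hcard : (Finset.univ.filter fun b' => Mx' b' ≠ M0 b').card ≤ n := by
          have hsub : (Finset.univ.filter fun b' => Mx' b' ≠ M0 b') ⊆
              (Finset.univ.filter fun b' => Mx b' ≠ M0 b').erase b := by
            intro b' hb'
            rw [Finset.mem_filter] at hb'
            rw [Finset.mem_erase, Finset.mem_filter]
            have hb'b : b' ≠ b := fun h => by
              rw [h, hMx', Function.update_self] at hb'
              exact hb'.2 rfl
            refine ⟨hb'b, Finset.mem_univ _, ?_⟩
            have := hb'.2
            rwa [hMx', Function.update_of_ne hb'b] at this
          have := Finset.card_le_card hsub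
          rw [Finset.card_erase_of_mem hbm] at this
          omega
        have hIH := ih Mx' hcard
        -- the swap relation: `p_{Mx} x₀ = p_{Mx'} q_b(Mx b)`
        have hswap := hrel _ (swapRel_mem_relSet (β := β) (δ := δ) L L' κM Mx M0 b)
        simp only [swapRel, map_sub, map_mul, eval_X] at hswap
        rw [← hx₀, sub_eq_zero, ← hMx', hIH, hq b (Mx b)] at hswap
        -- solve for `p_{Mx}`
        set E := ∏ b' ∈ Finset.univ.erase b, (lat L L' b').univExtP (Mx b') (z b') with hE
        have hE1 : ∏ b', (lat L L' b').univExtP (Mx' b') (z b') = (lat L L' b).univExtP (M0 b) (z b) * E := by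
          rw [← Finset.mul_prod_erase _ _ (Finset.mem_univ b), hMx', Function.update_self]
          congr 1
          exact Finset.prod_congr rfl fun b' hb' => by rw [Function.update_of_ne (Finset.ne_of_mem_erase hb')]
        have hE2 : ∏ b', (lat L L' b').univExtP (Mx b') (z b') = (lat L L' b).univExtP (Mx b) (z b) * E :=
          (Finset.mul_prod_erase _ _ (Finset.mem_univ b)).symm
        have hgoal : x (none, (Mx, none)) * x₀ = (C₀ * ∏ b', (lat L L' b').univExtP (Mx b') (z b')) * x₀ := by
          rw [hswap, hE1, hE2, hx₀b b]
          ring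
        exact mul_right_cancel₀ hx₀ne hgoal
  have hp : ∀ Mx : γ ⊕ γ' → Fin 3, x (none, (Mx, none)) = C₀ * ∏ b, (lat L L' b).univExtP (Mx b) (z b) :=
    fun Mx => hrank _ Mx le_rfl
  -- (4) the torus part by logarithms
  set y : β → ℂ := fun j => Complex.log (x (some j, (M0, none)) / x₀) with hy
  -- (5) the fibre coordinates from the chart ratios
  set Zsum : δ → ℂ := fun e => ∑ b, (κM e b : ℂ) * ((lat L L' b).univExtZ (M0 b) (z b) *
    ∏ b' ∈ Finset.univ.erase b, (lat L L' b').univExtP (M0 b') (z b')) with hZsum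
  set sc : δ → ℂ := fun e => (x (none, (M0, some e)) / C₀ + Zsum e) / Pi0 with hsc
  -- the point
  let w : β ⊕ ((γ ⊕ γ') ⊕ δ) → ℂ := fun k => Sum.elim y (Sum.elim z sc) k
  have hwy : ∀ j, w (iy j) = y j := fun j => by simp [w, iy]
  have hwz : ∀ b, w (iz b) = z b := fun b => by simp [w, iz]
  have hws : ∀ e, w (is e) = sc e := fun e => by simp [w, is]
  have hPnone : ∀ Mx : γ ⊕ γ' → Fin 3, thetaPnone (β := β) (δ := δ) L L' Mx w = ∏ b, (lat L L' b).univExtP (Mx b) (z b) := by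
    intro Mx
    unfold thetaPnone
    exact Finset.prod_congr rfl fun b _ => by rw [hwz]
  have hPi0w : thetaPnone (β := β) (δ := δ) L L' M0 w = Pi0 := hPnone M0
  have hx₀eq : x₀ = C₀ * Pi0 := by rw [hC₀]; field_simp
  -- torus coordinates
  have hT : ∀ a : Option β, x (a, (M0, none)) = thetaT (γ := γ ⊕ γ') (δ := δ) a w * x₀ := by
    rintro (_ | j)
    · rw [thetaT_none, one_mul]
    · rw [thetaT_some, hwy]
      simp only [hy]
      rw [Complex.exp_log (div_ne_zero (hta (some j)) hx₀ne)]
      field_simp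
  -- the chart fibre coordinate
  have hPsome0 : ∀ e, C₀ * thetaPsome (β := β) L L' κM M0 e w = x (none, (M0, some e)) := by
    intro e
    have h1 : thetaPsome (β := β) L L' κM M0 e w = sc e * Pi0 - Zsum e := by
      unfold thetaPsome
      rw [hws, hPi0w]
      simp only [hZsum, hwz]
    rw [h1]
    simp only [hsc]
    field_simp
    ring
  -- (6) all the fibre coordinates, by the exchange relations
  have hPsome : ∀ (Mx : γ ⊕ γ' → Fin 3) (e : δ),
      x (none, (Mx, some e)) = C₀ * thetaPsome (β := β) L L' κM Mx e w := by
    intro Mx e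
    -- the relation at `x` and at `Θ(w)`
    have hxrel := hrel _ (exchangeRel_mem_relSet (β := β) L L' κM Mx M0 e)
    have hwrel := (exchangeRel_mem_relSet (β := β) L L' κM Mx M0 e).2 w
    -- the exchange forms at `x` are `C₀²` times their values at `w`
    have hQ : ∀ b, eval x (exchangeForm (β := β) (δ := δ) (lat L L' b) Mx M0 b) =
        C₀ ^ 2 * thetaEval L L' κM (exchangeForm (β := β) (δ := δ) (lat L L' b) Mx M0 b) w := by
      intro b
      simp only [exchangeForm, thetaEval, map_add, map_mul, eval_X, eval_C, hp, theta_none_eq, thetaP_none, hPnone]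
      ring
    have hxrel' : x (none, (Mx, some e)) * x₀ - x (none, (M0, some e)) * x (none, (Mx, none)) +
        ∑ b, (κM e b : ℂ) * (C₀ ^ 2 * thetaEval L L' κM (exchangeForm (β := β) (δ := δ) (lat L L' b) Mx M0 b) w) = 0 := by
      simp only [exchangeRel, map_add, map_sub, map_mul, map_sum, eval_X, eval_C, hQ] at hxrel
      rw [← hx₀] at hxrel
      exact hxrel
    have hwrel' : thetaPsome (β := β) L L' κM Mx e w * Pi0 - thetaPsome (β := β) L L' κM M0 e w * thetaPnone (β := β) (δ := δ) L L' Mx w +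
        ∑ b, (κM e b : ℂ) * thetaEval L L' κM (exchangeForm (β := β) (δ := δ) (lat L L' b) Mx M0 b) w = 0 := by
      simp only [exchangeRel, thetaEval, map_add, map_sub, map_mul, map_sum, eval_X, eval_C, theta_none_eq,
        thetaP_none, thetaP_some] at hwrel
      rw [hPi0w] at hwrel
      exact hwrel
    have hsum : ∑ b, (κM e b : ℂ) * (C₀ ^ 2 * thetaEval L L' κM (exchangeForm (β := β) (δ := δ) (lat L L' b) Mx M0 b) w) =
        C₀ ^ 2 * ∑ b, (κM e b : ℂ) * thetaEval L L' κM (exchangeForm (β := β) (δ := δ) (lat L L' b) Mx M0 b) w := by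
      rw [Finset.mul_sum]
      exact Finset.sum_congr rfl fun b _ => by ring
    rw [hsum, ← hPsome0 e, hp Mx, ← hPnone Mx, hx₀eq] at hxrel'
    have hkey : (x (none, (Mx, some e)) - C₀ * thetaPsome (β := β) L L' κM Mx e w) * (C₀ * Pi0) = 0 := by
      linear_combination hxrel' - C₀ ^ 2 * hwrel'
    rcases mul_eq_zero.mp hkey with h | h
    · exact sub_eq_zero.mp h
    · exact absurd h (mul_ne_zero hC₀ne hPi0ne)
  -- (7) conclusion
  refine ⟨C₀, w, funext fun J => ?_⟩
  obtain ⟨a, Mx, o⟩ := J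
  have hS := hSegre a (Mx, o)
  rw [hT a] at hS
  have hx : x (a, (Mx, o)) = thetaT (γ := γ ⊕ γ') (δ := δ) a w * x (none, (Mx, o)) := by
    have : (x (a, (Mx, o)) - thetaT (γ := γ ⊕ γ') (δ := δ) a w * x (none, (Mx, o))) * x₀ = 0 := by
      linear_combination hS
    exact sub_eq_zero.mp ((mul_eq_zero.mp this).resolve_right hx₀ne)
  rw [hx]
  simp only [Pi.smul_apply, smul_eq_mul, thetaVec_apply, theta]
  rcases o with _ | e
  · rw [thetaP_none, hp Mx, ← hPnone Mx]
    ring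
  · rw [thetaP_some, hPsome Mx e]
    ring

omit [Fintype δ] in
/-- **The image theorem in the shape of the field `surj`** (hypotheses: `x` kills every form
vanishing on `Θ(V)`, and some boundary form is non-zero at `x`). [cite: NesterenkoPhilippon2001, Ch. 11 §2.1] -/
theorem theta_surj' (x : Option β × ThetaIdx (γ ⊕ γ') δ → ℂ)
    (hrel : ∀ (P : MvPolynomial (Option β × ThetaIdx (γ ⊕ γ') δ) ℂ) (d : ℕ), P.IsHomogeneous d →
      (∀ w, thetaEval L L' κM P w = 0) → eval x P = 0)
    (hb : ∃ M : Option β → (γ ⊕ γ' → Fin 3), eval x (bdryForm (δ := δ) M) ≠ 0) :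
    ∃ (c : ℂ) (w : β ⊕ ((γ ⊕ γ') ⊕ δ) → ℂ), x = c • thetaVec L L' κM w :=
  theta_surj L L' κM x (fun P hP => by obtain ⟨⟨d, hd⟩, h0⟩ := hP; exact hrel P d hd h0) hb



end Std

end GaGmEE

end Literature.NumberTheory.Transcendental

end
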